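import Mathlib
import Summits.ValiantsHypothesis.ValiantsHypothesis.Cruxes.NNLinearDegreeCofactorHard.Lines.xc_division
import Summits.ValiantsHypothesis.ValiantsHypothesis.Theorems.FifoMatchingNNDivisionHardCorSandwich
import Literature.Barriers.PneNP.ExtendedFormulationLinearImage
import Literature.Barriers.PneNP.CorrelationPolytopeXCLowerBoundGraph
import Literature.Combinatorics.Optimization.CorrelationPolytopeGridMinor
import Literature.Barriers.PneNP.ExtendedFormulationMinkowskiFaces
import Summits.ValiantsHypothesis.ValiantsHypothesis.Theorems.FifoMatchingXcDivisionZmixFace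
import Summits.ValiantsHypothesis.ValiantsHypothesis.Theorems.FifoMatchingNNDivisionHardSwitchedFaceTower

/-!
# DELETION-LOCALIZATION of the COR-VIRTUAL partition (crux `NNDivisionHard`, stmt-ValiantsHypothesis-21181)

Crux workfile of val-idea-43 g5 (W6-P2 co-seat by lineage 39/43, director-valiant R303 (3); crux idea card
`Ideas/deletion-localization.md`).  LINE of record: `Cruxes/NNDivisionHard/Lines/virtual_passenger.lean` rev 16 (pen val-idea-42 g2):
`NNDivisionHard_of : fact_BFPS2012 → stub_udisjCorruption → stub_coreLaw → …Theses.FifoMatching.NNDivisionHard`, where the research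
stub C♭ `CoreLaw` is `CorVirtualHard` restricted to the complement of FOURTEEN decided sub-populations, every one of them a predicate
`X h q` read AT THE FULL SCALE `h`.

## The lever (one move, kernel-checked here)

**The coordinate-DELETION minor.**  For an injection `ι : Fin ℓ ↪ Fin h` the read `π_ι x := (x (ι i, ι j))_{i j}` is linear, maps
`COR(K_h)` ONTO `COR(K_ℓ)` (`delRead_image_cor`), and maps `COR(K_h) + conv q` onto `COR(K_ℓ) + conv (π_ι ∘ q)` keeping every
extended-formulation size and every passenger budget (`hasEFOfSize_pair_del`, `hasEFOfSize_hull_del`; Aboulker–Fiorini–Huynh–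
Macchia–Seif 2019 Obs. 5 «xc(COR(·)) is minor-monotone», here WITH the passenger riding along).  Monotonicity alone is useless at the
crux's rate: a class theorem applied on the minor yields `T c ℓ < r`, and `T c ℓ ≤ T c h` is the WRONG direction.  The lever is the
CURRENCY EXCHANGE `T c h ≤ T (2c) ℓ` for `⌊√h⌋ ≤ ℓ` (`T_le_T_double`; `T c n = 2^((log₂ n + c)^c)`): the route's `∀ c` quantifier
absorbs the loss of scale, so a class decided «for every `c`» at scale `ℓ ≥ √h` decides at scale `h`.  Hence ONE abstract theorem
for every class typed in the line's `∀ c ∃ h₀` shape — present (all fourteen: A⁺ D E B F G H K K_θ R R* S E♭ K^aff) or future: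

* `decided_loc : Decided X → Decided (Loc X)`, `Loc X h q :≡ ∃ ℓ ≥ ⌊√h⌋, ∃ ι : Fin ℓ ↪ Fin h, X ℓ (π_ι ∘ q)` («`q` lies in `X`
  on SOME deletion minor of size `≥ √h`»; `X ≤ Loc X` by `le_loc`; iterating gives minors of size `≥ h^{1/4}, h^{1/8}, …` —
  `decided_loc (decided_loc hX)`; the general form `decided_locAt` takes any scale function with a currency exchange, which is
  exactly what a polylog scale LACKS in `T`-currency: the floor of this move is `h^ε`, stated, not hidden);
* `ResidualLaw X` := «every budgeted pair outside `X` is hard» (the shape of C♭ relative to a decided cone `X`; the line's `CoreLaw` is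
  `ResidualLaw` of the fourteen-fold disjunction at `θ = 1/2`, `τ = τ₀`), `corVirtualHard_of_residualLaw : Decided X → ResidualLaw X →
  CorVirtualHard` (the line's partition glue, abstractly), and ★ `corVirtualHard_of_residualLawLoc : Decided X →
  ResidualLaw (Loc X) → CorVirtualHard` with `residualLawLoc_of : ResidualLaw X → ResidualLaw (Loc X)` — the LOCALIZED residual
  C♭_loc is WEAKER than C♭ (its enemy must be residual on EVERY deletion minor of size `≥ √h`: `not_loc_iff`, necessary condition
  N19 «no quiet minor») and still reaches `CorVirtualHard` (restated VERBATIM from the line's §1; socket = `id`) — hence 21181 by the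
  line's `nnDivisionHard_of_corVirtual`, one δ-step, BY NAME;
* a sorry-free INSTANCE needing no class of the line: `Quiet` (constant generator families) is decided (`quiet_decided`: `COR(K_ℓ)` +
  point, Kaibel–Weltge `2^{ℓ/2} ≤ r` ✓ `corPolytopeGraph_top_two_pow_half_le`, threshold ✓ `CorSandwich.threshold_lt_of_rpow_bound`),
  so `Loc Quiet` — «the passenger is CONSTANT on some `√h × √h` principal minor» (a QUIET CORNER; globally it may be anything: no
  common extremiser, not shallow, not sparse, full-dimensional, unbudgeted even) — is a decided class: `quietCorner_decided`.  Since
  `Quiet ⊆ F ⊆ S ⊆ U` and `Quiet ⊆ K`, the pen obtains `Loc F`, `Loc S`, `Loc K`, … from `decided_loc` and the line's own class theorems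
  verbatim (this file cannot import the line: crux workfiles are cited, not imported).

## §6 (rev 2) — DELETION-LOCATED families: crit-9 g2's N20 (P2) typed in the face currency

`DelLocated h q :≡ ∃ x₀ C M, C valid on COR(K_h) with max M, tight on the WHOLE deletion face {b : b_{x₀} = 0}, and a UNIQUE
maximising passenger point` — the mirror of the line's CLASS W `SwitchLocated` (tight set = switched face `{b_a = 1}` exactly) under
the switching symmetry of `COR`, not inside G (diagonal directions) nor E♭ (admissible directions).  ★ `delLocated_decided :
Decided DelLocated` (PROVED: two `face_add_face₁` cuts, the deletion minor `delRead (succAbove x₀)` of §1 maps the deletion face ONTO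
`COR(K_{h−1})` — `delRead_image_delFace` —, Kaibel–Weltge, threshold).  Instances: ★ `delLocated_of_entryMin` — ONE matrix entry
`(x, x')` with a unique minimising generator point (functional `−E_{xx'}`; kills crit-9's `Q∘` «with one entry»: `(q_P)_{xx'} =
n²(1 − P_x − P_{x'}) + n|P|` has the unique minimiser `P* = {x, x'}`) ⇒ `entryMin_decided`; ★ `delLocated_of_colTilt` — N20's NEGATIVE
COLUMN TILT `W = −Σ_l M_l E_{l x₀}`, `M ≥ 0`, with a unique `W`-maximising point (affine cubes with a tilt-live column);
`delLocatedCorner_decided : Decided (Loc DelLocated)` by §3; enemy side N21 `enemy_not_delLocated`: below the threshold, on every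
`√h` deletion minor, every matrix entry of the read generators attains its minimum at two DISTINCT points and no nonnegative column
tilt has a unique maximiser.

## §7 (rev 3) — SWITCHING: a second free functor, at NO cost in scale

The switching `σ_a` (flip coordinate `a`) is an affine automorphism of `COR(K_h)`: `σ_a = L_a + E_{aa}` (`swLin`, `diagUnit`;
`swLin_corVec`, ★ `swLin_image_cor_add : L_a '' COR + {E_{aa}} = COR`).  Hence ★ `hasEFOfSize_pair_sw` (an EF of the pair is an EF of
`COR + conv(L_a ∘ q)`, same size) and ★★ `decided_sw : Decided X → Decided (Sw X)`, `Sw X h q :≡ ∃ a, X h (L_a ∘ q)`, SAME threshold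
(`decidedB_sw` budgeted).  Orbit step `Orb X := Loc (X ∨ Sw X)`, `decided_orb`, ★★★ glue `corVirtualHard_of_residualLawOrb (hX : Decided X)
(hR : ResidualLaw (Orb X)) : CorVirtualHard`; enemy side N22 `enemy_not_sw`.  For the pen: «decided ⇒ decided on every `√h` minor AND
after every switching», for all fifteen classes, by one theorem each.

## §8 (rev 4) — THE DIAGONAL PERMUTAHEDRON `Q^Π_λ` (crit-9 g2's «open question of wave 6», 22:52:44Z) IS DECIDED IN FACE CURRENCY

`qPerm λ π = −λ·diag(π+1)`.  ★★ `qPerm_swDelLocated`: `Q^Π_λ ∈ Sw DelLocated` (switch at `a`, then N20's column tilt `−Σ_l ω(l)E_{la}`,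
`ω(a) = 0`; value `λΣ ω_l(π_l+1)`, unique maximiser `π = ω` by ★ `sum_mul_perm_lt` = the square identity) ⇒ ★★★ `diagPermutahedron_decided`
(`∀ λ > 0 ∀ c ∃ h₀ ∀ h ≥ h₀ ∀ K (e : Fin (K+1) → S_h) surjective ∀ r, EF of COR(K_h) + Q^Π_λ of size r ⇒ T c h < r`).  §8b: unswitched, the
certificate is `C = E_{aa} + Σ_{i≠a} ω(i)(E_{ia} − E_{ii})` (`permSwitchFun`; valid on `COR`, max `1` iff `b_a = 1`; `permSwitchFun_corVec`,
`permSwitchFun_qPerm`) ⇒ ★★ `qPerm_switchExposed : SwitchExposed n (qPerm λ ∘ e)` — `Q^Π_λ` is literally in CLASS W — ⇒ ★★★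
`diagPermutahedron_three_pow_le : 3^n ≤ (r+1)·2^n` BY NAME from the landed engine ✓ `SwitchFace.switchExposed_three_pow_le`
(`Theorems/FifoMatchingNNDivisionHardSwitchedFaceTower`).  So LINE rev 17 already decides `Q^Π` in xc currency; the LAW-currency reading
(paper, module docstring of §8): exact-rhs located rows at the switched face decide it (UDISJ_{h−1} on `{b ∋ a} × {ω}`), box-rhs rows are
blind there by the constant `D = h(h−1)/2` — consistent with crit-9's reduction of C⁺_entry-blindness to `rank₊ M_{a,σ}`.

## §9 (rev 5) — THE PAIR SIEVE: membership read off the VERTEX LIST (N23, pair version, in kernel)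

★ `exists_nonneg_separating` (moment curve `ω_l = t^l`, `t` beyond every root of the difference polynomials): finitely many vectors are
pairwise separated by ONE nonnegative weight.  Hence ★★ `delLocated_of_colSep` / `colSep_decided`: a passenger ONE OF WHOSE COLUMNS
separates its distinct vertices is in `DelLocated`, decided; ★★ `sw_colSep_of_switchSep` / `switchSep_decided`: the same for ONE SWITCHED
column (data `(q_j(a,a), (q_j(l,l) − q_j(l,a))_{l≠a})`); `orb_colSep_decided` = both on every `√h` minor and switching.  ENEMY READING:
a C♭-candidate needs, for EVERY `x₀`, two distinct vertices sharing column `x₀`, and for EVERY `a`, two sharing the switched column, on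
every large minor.  `qPerm_switchSep` / `qPerm_switchSep_decided`: `Q^Π_λ` fails the sieve at every `a` (third exclusion).

## Honest weight

What is monotone here: `xc` under the linear read (Literature).  What is not: the exchange `T c h ≤ T (2c) ℓ` and the quantifier flip
it buys in the residual (`¬ Loc X` = «for ALL minors», a hereditary enemy spec obtained for free for every class at once, value classes
S / R / K included with their tolerances re-scaled to the minor).  What it does NOT do: decide any explicit member of C♭ (none is known to
anyone — CRITIC-wave5 §(E7)); beat the clique-row cap ✓ p671347 (the cap concerns certificates reading clique-row slack VALUES; a
deletion minor reads exact sub-slack-matrices, and `Loc cliqueRows`-type value laws stay refuted on `Q♮`, which is self-similar under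
deletion: `π_L Q♮ ⊇` an affine cube on `L`); reach polylog minors.  It is the DELETION half of a minor calculus whose CONTRACTION half
(pair-pinning = entry-tilt location + representative read) is val-idea-38's located rungs / crit-9 g2's N18 (c) «hereditarily blind
under pair-pinning»; together: a COR-VIRTUAL enemy must be residual on every correlation MINOR of size `≥ h^ε`.

Nothing here proves the crux: 21181 OPEN; COR-VIRTUAL / C♭ / C⁺ OPEN; VP ≠ VNP is NOT proved.
-/

set_option linter.unusedVariables false
set_option linter.unusedSectionVars false
-- single-conjunct layout: Sub = Summit, duplicated namespace component intended
set_option linter.dupNamespace false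

namespace Summit.ValiantsHypothesis.ValiantsHypothesis.Cruxes.NNDivisionHard.Localization43

open Matrix Finset
open scoped Pointwise
open Literature.Barriers.PneNP (HasEFOfSize corPolytopeGraph_top_two_pow_half_le)
open Literature.Combinatorics.Optimization (corPolytopeGraph corVec corVec_apply_diag corVec_apply_adj corVec_zero_or_one)
open Summit.ValiantsHypothesis.ValiantsHypothesis.Theorems.FifoMatching (XcDivision.dot_le_of_mem_convexHull XcDivision.convexHull_range_inter_eq)
open Summit.ValiantsHypothesis.ValiantsHypothesis.Cruxes.NNLinearDegreeCofactorHard.XcDivision (T)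
open Summit.ValiantsHypothesis.ValiantsHypothesis.Theorems.FifoMatching.CorSandwich (threshold_lt_of_rpow_bound)

/-! ## §0 The target, restated VERBATIM from the line (§1 `VPLine.CorVirtualHard`; socket for the pen = `id`) -/

/-- **COR-VIRTUAL (the budgeted law; = vxc(COR(K_h)) super-quasi-polynomial, Hertrich–Loho Q5.1 at COR)** — verbatim copy of
`…Cruxes.NNLinearDegreeCofactorHard.XcDivision.VPLine.CorVirtualHard` of `Lines/virtual_passenger.lean` (same constants `T`,
`corPolytopeGraph`, `HasEFOfSize`), which the line turns into the crux by `nnDivisionHard_of_corVirtual`. -/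
def CorVirtualHard : Prop :=
  ∀ c : ℕ, ∃ h₀ : ℕ, ∀ h ≥ h₀, ∀ (K : ℕ) (q : Fin (K + 1) → (Fin h × Fin h → ℝ)) (r : ℕ),
    HasEFOfSize (convexHull ℝ (Set.range q)) r →
    HasEFOfSize (corPolytopeGraph (⊤ : SimpleGraph (Fin h)) + convexHull ℝ (Set.range q)) r → T c h < r

/-- generator families of a passenger at scale `h` (the line's `q : Fin (K + 1) → (Fin h × Fin h → ℝ)`). -/
abbrev Fam (h K : ℕ) : Type := Fin (K + 1) → (Fin h × Fin h → ℝ)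

/-- a PASSENGER CLASS: a predicate on generator families at every scale (each of the line's fourteen classes is one, e.g.
`fun h K q => CommonExtremiser h q`, `fun h K q => Shallow h q`, `fun h K q => MixedRooted τ₀ h q`). -/
abbrev PClass : Type := ∀ h K : ℕ, Fam h K → Prop

/-- «class `X` is DECIDED»: the exact shape of every class theorem of the line (`shallow_decided hW`, `cutDominant_decided hM`,
`nearRooted_decided hU`, `rate_of_lvl ∘ …_three_halves_pow_le`, …): membership plus a size-`r` extended formulation of
`COR(K_h) + conv q` forces `T c h < r`, eventually in `h`, for every `c`.  (No budget hypothesis: none of the fourteen uses it.) -/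
def Decided (X : PClass) : Prop :=
  ∀ c : ℕ, ∃ h₀ : ℕ, ∀ h ≥ h₀, ∀ (K : ℕ) (q : Fam h K) (r : ℕ),
    X h K q → HasEFOfSize (corPolytopeGraph (⊤ : SimpleGraph (Fin h)) + convexHull ℝ (Set.range q)) r → T c h < r

/-- «the RESIDUAL LAW relative to the cone `X`»: every BUDGETED pair outside `X` is hard — the shape of the line's research stub
(`CoreLaw` = `ResidualLaw` of the disjunction of the fourteen class predicates at `θ = 1/2`, `τ = τ₀`). -/
def ResidualLaw (X : PClass) : Prop :=
  ∀ c : ℕ, ∃ h₀ : ℕ, ∀ h ≥ h₀, ∀ (K : ℕ) (q : Fam h K) (r : ℕ),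
    ¬ X h K q → HasEFOfSize (convexHull ℝ (Set.range q)) r →
    HasEFOfSize (corPolytopeGraph (⊤ : SimpleGraph (Fin h)) + convexHull ℝ (Set.range q)) r → T c h < r

/-- **the partition glue, abstractly** (= the line's `corVirtualHard_of_partition'` with the case analysis packed into `X`). -/
theorem corVirtualHard_of_residualLaw {X : PClass} (hX : Decided X) (hR : ResidualLaw X) : CorVirtualHard := by
  intro c
  obtain ⟨h₁, hh₁⟩ := hX c
  obtain ⟨h₂, hh₂⟩ := hR c
  refine ⟨h₁ + h₂, fun h hh K q r hB hEF => ?_⟩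
  by_cases hq : X h K q
  · exact hh₁ h (by omega) K q r hq hEF
  · exact hh₂ h (by omega) K q r hq hB hEF

/-- a larger cone leaves a weaker residual law. -/
theorem residualLaw_mono {X Y : PClass} (hXY : ∀ h K (q : Fam h K), X h K q → Y h K q) (hR : ResidualLaw X) :
    ResidualLaw Y := by
  intro c
  obtain ⟨h₀, hh₀⟩ := hR c
  exact ⟨h₀, fun h hh K q r hq hB hEF => hh₀ h hh K q r (fun hx => hq (hXY h K q hx)) hB hEF⟩

/-- decidedness is monotone the other way: a sub-population of a decided class is decided. -/
theorem decided_anti {X Y : PClass} (hXY : ∀ h K (q : Fam h K), X h K q → Y h K q) (hY : Decided Y) : Decided X := by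
  intro c
  obtain ⟨h₀, hh₀⟩ := hY c
  exact ⟨h₀, fun h hh K q r hq hEF => hh₀ h hh K q r (hXY h K q hq) hEF⟩

/-- the union of two decided classes is decided (how the line's fourteen `by_cases` become one cone). -/
theorem decided_or {X Y : PClass} (hX : Decided X) (hY : Decided Y) : Decided (fun h K q => X h K q ∨ Y h K q) := by
  intro c
  obtain ⟨h₁, hh₁⟩ := hX c
  obtain ⟨h₂, hh₂⟩ := hY c
  refine ⟨h₁ + h₂, fun h hh K q r hq hEF => ?_⟩
  rcases hq with hq | hq
  · exact hh₁ h (by omega) K q r hq hEF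
  · exact hh₂ h (by omega) K q r hq hEF

/-! ## §1 The deletion minor `π_ι` -/

/-- the coordinate-DELETION read along an injection `ι : Fin ℓ ↪ Fin h`: `(π_ι x) (i, j) = x (ι i, ι j)`. -/
def delRead {ℓ h : ℕ} (ι : Fin ℓ ↪ Fin h) : (Fin h × Fin h → ℝ) →ₗ[ℝ] (Fin ℓ × Fin ℓ → ℝ) :=
  LinearMap.funLeft ℝ ℝ (fun ij : Fin ℓ × Fin ℓ => (ι ij.1, ι ij.2))

theorem delRead_apply {ℓ h : ℕ} (ι : Fin ℓ ↪ Fin h) (x : Fin h × Fin h → ℝ) (i j : Fin ℓ) :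
    delRead ι x (i, j) = x (ι i, ι j) := rfl

/-- the identity read changes nothing. -/
theorem delRead_refl {h : ℕ} (x : Fin h × Fin h → ℝ) : delRead (Function.Embedding.refl (Fin h)) x = x := by
  funext ij
  rfl

/-- reads compose: a minor of a minor is a minor. -/
theorem delRead_trans {m ℓ h : ℕ} (κ : Fin m ↪ Fin ℓ) (ι : Fin ℓ ↪ Fin h) (x : Fin h × Fin h → ℝ) :
    delRead κ (delRead ι x) = delRead (κ.trans ι) x := by
  funext ij
  rfl

/-- `π_ι` of a `COR(K_h)` vertex is the `COR(K_ℓ)` vertex of the restricted subset. -/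
theorem delRead_corVec {ℓ h : ℕ} (ι : Fin ℓ ↪ Fin h) (b : Fin h → Bool) :
    delRead ι (corVec (⊤ : SimpleGraph (Fin h)) b) = corVec (⊤ : SimpleGraph (Fin ℓ)) (b ∘ ι) := by
  funext ij
  obtain ⟨i, j⟩ := ij
  rw [delRead_apply]
  unfold corVec
  simp only [SimpleGraph.top_adj, Function.comp, ι.injective.eq_iff, ne_eq]
  by_cases hij : i = j
  · simp [hij]
  · simp [hij]

/-- ★ **the deletion minor of `COR(K_h)` is `COR(K_ℓ)`** (onto: every subset of the minor extends). -/
theorem delRead_image_cor {ℓ h : ℕ} (ι : Fin ℓ ↪ Fin h) :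
    delRead ι '' corPolytopeGraph (⊤ : SimpleGraph (Fin h)) = corPolytopeGraph (⊤ : SimpleGraph (Fin ℓ)) := by
  unfold corPolytopeGraph
  rw [LinearMap.image_convexHull, ← Set.range_comp]
  congr 1
  ext y
  constructor
  · rintro ⟨b, rfl⟩
    exact ⟨b ∘ ι, (delRead_corVec ι b).symm⟩
  · rintro ⟨a, rfl⟩
    refine ⟨Function.extend ι a (fun _ => false), ?_⟩
    show delRead ι (corVec ⊤ (Function.extend ι a (fun _ => false))) = corVec ⊤ a
    rw [delRead_corVec]
    congr 1
    funext p
    exact ι.injective.extend_apply _ _ p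

/-- the passenger rides along: `π_ι (conv q) = conv (π_ι ∘ q)`. -/
theorem delRead_image_hull {ℓ h K : ℕ} (ι : Fin ℓ ↪ Fin h) (q : Fam h K) :
    delRead ι '' convexHull ℝ (Set.range q) = convexHull ℝ (Set.range (⇑(delRead ι) ∘ q)) := by
  rw [LinearMap.image_convexHull, ← Set.range_comp]

/-- BUDGETS survive deletion (`xc` of a linear image, Literature `HasEFOfSize.image_linearMap`). -/
theorem hasEFOfSize_hull_del {ℓ h K : ℕ} (ι : Fin ℓ ↪ Fin h) (q : Fam h K) {r : ℕ}
    (hB : HasEFOfSize (convexHull ℝ (Set.range q)) r) :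
    HasEFOfSize (convexHull ℝ (Set.range (⇑(delRead ι) ∘ q))) r := by
  have h1 := hB.image_linearMap (delRead ι)
  rwa [delRead_image_hull] at h1

/-- ★ SIZES survive deletion: an EF of `COR(K_h) + conv q` of size `r` gives one of `COR(K_ℓ) + conv (π_ι ∘ q)`. -/
theorem hasEFOfSize_pair_del {ℓ h K : ℕ} (ι : Fin ℓ ↪ Fin h) (q : Fam h K) {r : ℕ}
    (hEF : HasEFOfSize (corPolytopeGraph (⊤ : SimpleGraph (Fin h)) + convexHull ℝ (Set.range q)) r) :
    HasEFOfSize (corPolytopeGraph (⊤ : SimpleGraph (Fin ℓ)) + convexHull ℝ (Set.range (⇑(delRead ι) ∘ q))) r := by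
  have h1 := hEF.image_linearMap (delRead ι)
  rwa [Set.image_add, delRead_image_cor, delRead_image_hull] at h1

/-! ## §2 The currency exchange: the `∀ c` quantifier absorbs the loss of scale -/

/-- `log₂ h ≤ 2 log₂ ℓ + 1` once `⌊√h⌋ ≤ ℓ`. -/
theorem log_two_le_of_sqrt_le {h ℓ : ℕ} (hℓ : Nat.sqrt h ≤ ℓ) : Nat.log 2 h ≤ 2 * Nat.log 2 ℓ + 1 := by
  rcases Nat.eq_zero_or_pos h with rfl | hpos
  · simp
  have h1 : h < (ℓ + 1) * (ℓ + 1) :=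
    lt_of_lt_of_le (Nat.lt_succ_sqrt h) (Nat.mul_le_mul (by omega) (by omega))
  have h2 : ℓ < 2 ^ (Nat.log 2 ℓ + 1) := Nat.lt_pow_succ_log_self (by norm_num) ℓ
  have h3 : (ℓ + 1) * (ℓ + 1) ≤ 2 ^ (Nat.log 2 ℓ + 1) * 2 ^ (Nat.log 2 ℓ + 1) :=
    Nat.mul_le_mul (by omega) (by omega)
  have h4 : h < 2 ^ (2 * Nat.log 2 ℓ + 2) := by
    calc h < (ℓ + 1) * (ℓ + 1) := h1
      _ ≤ 2 ^ (Nat.log 2 ℓ + 1) * 2 ^ (Nat.log 2 ℓ + 1) := h3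
      _ = 2 ^ (2 * Nat.log 2 ℓ + 2) := by rw [← pow_add]; ring_nf
  have h5 := Nat.log_lt_of_lt_pow (by omega) h4
  omega

/-- ★ **THE EXCHANGE**: `T c h ≤ T (2c) ℓ` whenever `⌊√h⌋ ≤ ℓ` (`T c n = 2^((log₂ n + c)^c)`). -/
theorem T_le_T_double (c : ℕ) {h ℓ : ℕ} (hℓ : Nat.sqrt h ≤ ℓ) : T c h ≤ T (2 * c) ℓ := by
  have hL := log_two_le_of_sqrt_le hℓ
  show 2 ^ ((Nat.log 2 h + c) ^ c) ≤ 2 ^ ((Nat.log 2 ℓ + 2 * c) ^ (2 * c))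
  apply Nat.pow_le_pow_right (by norm_num)
  rcases Nat.eq_zero_or_pos c with rfl | hc
  · simp
  calc (Nat.log 2 h + c) ^ c ≤ (2 * Nat.log 2 ℓ + 1 + c) ^ c := Nat.pow_le_pow_left (by omega) c
    _ ≤ ((Nat.log 2 ℓ + 2 * c) ^ 2) ^ c := Nat.pow_le_pow_left (by nlinarith) c
    _ = (Nat.log 2 ℓ + 2 * c) ^ (2 * c) := by rw [← pow_mul, mul_comm]

/-! ## §3 The localization functor `Loc` and THE LOCALIZATION THEOREM -/

/-- **`LocAt s X`**: `q` lies in the class `X` on SOME deletion minor of size at least `s h`. -/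
def LocAt (s : ℕ → ℕ) (X : PClass) : PClass := fun h K q =>
  ∃ ℓ : ℕ, s h ≤ ℓ ∧ ∃ ι : Fin ℓ ↪ Fin h, X ℓ K (⇑(delRead ι) ∘ q)

/-- **`Loc X`** — the `√h`-LOCALIZATION of `X`: `q ∈ X` on some deletion minor of size `≥ ⌊√h⌋`. -/
def Loc (X : PClass) : PClass := LocAt Nat.sqrt X

/-- the class itself is the identity minor: `X ≤ Loc X` (so `ResidualLaw (Loc X)` is WEAKER than `ResidualLaw X`). -/
theorem le_loc (X : PClass) {h K : ℕ} {q : Fam h K} (hq : X h K q) : Loc X h K q := by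
  refine ⟨h, Nat.sqrt_le_self h, Function.Embedding.refl (Fin h), ?_⟩
  have e : (⇑(delRead (Function.Embedding.refl (Fin h))) ∘ q) = q := by
    funext j
    exact delRead_refl (q j)
  rw [e]
  exact hq

theorem le_locAt {s : ℕ → ℕ} (hs : ∀ h, s h ≤ h) (X : PClass) {h K : ℕ} {q : Fam h K} (hq : X h K q) :
    LocAt s X h K q := by
  refine ⟨h, hs h, Function.Embedding.refl (Fin h), ?_⟩
  have e : (⇑(delRead (Function.Embedding.refl (Fin h))) ∘ q) = q := by
    funext j
    exact delRead_refl (q j)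
  rw [e]
  exact hq

/-- `Loc` is monotone in the class. -/
theorem locAt_mono (s : ℕ → ℕ) {X Y : PClass} (hXY : ∀ h K (q : Fam h K), X h K q → Y h K q) {h K : ℕ} {q : Fam h K}
    (hq : LocAt s X h K q) : LocAt s Y h K q := by
  obtain ⟨ℓ, hℓ, ι, hx⟩ := hq
  exact ⟨ℓ, hℓ, ι, hXY _ _ _ hx⟩

/-- **the enemy-side reading (N19)**: `q ∉ Loc X` iff `q` is OUTSIDE `X` ON EVERY deletion minor of size `≥ ⌊√h⌋` — a hereditary
necessary condition on any refuting pair, for every decided class at once («no quiet minor»). -/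
theorem not_loc_iff (X : PClass) {h K : ℕ} (q : Fam h K) :
    ¬ Loc X h K q ↔ ∀ ℓ : ℕ, Nat.sqrt h ≤ ℓ → ∀ ι : Fin ℓ ↪ Fin h, ¬ X ℓ K (⇑(delRead ι) ∘ q) := by
  unfold Loc LocAt
  push Not
  rfl

/-- ★★ **THE LOCALIZATION THEOREM, general scale**: if the scale function `s` is eventually above every constant and the currency
admits an exchange `T c h ≤ T c' ℓ` for `ℓ ≥ s h`, then `X` decided ⇒ `LocAt s X` decided. -/
theorem decided_locAt {s : ℕ → ℕ} {X : PClass}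
    (hgrow : ∀ h₀ : ℕ, ∃ h₁ : ℕ, ∀ h ≥ h₁, h₀ ≤ s h)
    (hex : ∀ c : ℕ, ∃ c' h₁ : ℕ, ∀ h ≥ h₁, ∀ ℓ, s h ≤ ℓ → T c h ≤ T c' ℓ)
    (hX : Decided X) : Decided (LocAt s X) := by
  intro c
  obtain ⟨c', h₁, hh₁⟩ := hex c
  obtain ⟨h₀, hh₀⟩ := hX c'
  obtain ⟨h₂, hh₂⟩ := hgrow h₀
  refine ⟨h₁ + h₂, fun h hh K q r hq hEF => ?_⟩
  obtain ⟨ℓ, hℓ, ι, hx⟩ := hq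
  have hℓ₀ : h₀ ≤ ℓ := le_trans (hh₂ h (by omega)) hℓ
  exact lt_of_le_of_lt (hh₁ h (by omega) ℓ hℓ) (hh₀ ℓ hℓ₀ K _ r hx (hasEFOfSize_pair_del ι q hEF))

/-- ★★ **THE LOCALIZATION THEOREM** (`√h` minors, exchange `c ↦ 2c`): `X` decided ⇒ `Loc X` decided. -/
theorem decided_loc {X : PClass} (hX : Decided X) : Decided (Loc X) := by
  refine decided_locAt (s := Nat.sqrt) ?_ ?_ hX
  · intro h₀
    refine ⟨h₀ * h₀, fun h hh => ?_⟩
    have e : Nat.sqrt (h₀ * h₀) = h₀ := Nat.sqrt_eq h₀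
    calc h₀ = Nat.sqrt (h₀ * h₀) := e.symm
      _ ≤ Nat.sqrt h := Nat.sqrt_le_sqrt hh
  · intro c
    exact ⟨2 * c, 0, fun h _ ℓ hℓ => T_le_T_double c hℓ⟩

/-- iterating: `h^{1/4}`-minors (`Loc (Loc X)`), `h^{1/8}`-minors, … are decided too — the floor of the move in `T`-currency is
`h^ε`, NOT polylog (no constant `c'` exchanges `T c h` against `T c' ((log h)^k)`). -/
theorem decided_loc_loc {X : PClass} (hX : Decided X) : Decided (Loc (Loc X)) :=
  decided_loc (decided_loc hX)

/-- the `h^{1/4}` scale directly (exchange `c ↦ 4c`, two square roots): `X` decided ⇒ `LocAt ⁴√· X` decided. -/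
theorem decided_locAt_fourthRoot {X : PClass} (hX : Decided X) :
    Decided (LocAt (fun h => Nat.sqrt (Nat.sqrt h)) X) := by
  refine decided_locAt ?_ ?_ hX
  · intro h₀
    refine ⟨(h₀ * h₀) * (h₀ * h₀), fun h hh => ?_⟩
    have e1 : Nat.sqrt ((h₀ * h₀) * (h₀ * h₀)) = h₀ * h₀ := Nat.sqrt_eq (h₀ * h₀)
    have e2 : Nat.sqrt (h₀ * h₀) = h₀ := Nat.sqrt_eq h₀
    have s1 : h₀ * h₀ ≤ Nat.sqrt h := by
      calc h₀ * h₀ = Nat.sqrt ((h₀ * h₀) * (h₀ * h₀)) := e1.symm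
        _ ≤ Nat.sqrt h := Nat.sqrt_le_sqrt hh
    calc h₀ = Nat.sqrt (h₀ * h₀) := e2.symm
      _ ≤ Nat.sqrt (Nat.sqrt h) := Nat.sqrt_le_sqrt s1
  · intro c
    refine ⟨2 * (2 * c), 0, fun h _ ℓ hℓ => ?_⟩
    exact le_trans (T_le_T_double c (le_refl (Nat.sqrt h))) (T_le_T_double (2 * c) hℓ)

/-! ### §3b The budget-aware variant (for class theorems that price the passenger, e.g. val-idea-41's few-zones law) -/

/-- «class `X` is DECIDED USING THE BUDGET»: as `Decided`, with the passenger's own size-`r` extended formulation as an extra hypothesis. -/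
def DecidedB (X : PClass) : Prop :=
  ∀ c : ℕ, ∃ h₀ : ℕ, ∀ h ≥ h₀, ∀ (K : ℕ) (q : Fam h K) (r : ℕ),
    X h K q → HasEFOfSize (convexHull ℝ (Set.range q)) r →
    HasEFOfSize (corPolytopeGraph (⊤ : SimpleGraph (Fin h)) + convexHull ℝ (Set.range q)) r → T c h < r

theorem decidedB_of_decided {X : PClass} (hX : Decided X) : DecidedB X := by
  intro c
  obtain ⟨h₀, hh₀⟩ := hX c
  exact ⟨h₀, fun h hh K q r hq _ hEF => hh₀ h hh K q r hq hEF⟩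

/-- budgets ride along the minor (`hasEFOfSize_hull_del`), so the localization theorem holds verbatim for budget-using classes. -/
theorem decidedB_locAt {s : ℕ → ℕ} {X : PClass}
    (hgrow : ∀ h₀ : ℕ, ∃ h₁ : ℕ, ∀ h ≥ h₁, h₀ ≤ s h)
    (hex : ∀ c : ℕ, ∃ c' h₁ : ℕ, ∀ h ≥ h₁, ∀ ℓ, s h ≤ ℓ → T c h ≤ T c' ℓ)
    (hX : DecidedB X) : DecidedB (LocAt s X) := by
  intro c
  obtain ⟨c', h₁, hh₁⟩ := hex c
  obtain ⟨h₀, hh₀⟩ := hX c'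
  obtain ⟨h₂, hh₂⟩ := hgrow h₀
  refine ⟨h₁ + h₂, fun h hh K q r hq hB hEF => ?_⟩
  obtain ⟨ℓ, hℓ, ι, hx⟩ := hq
  have hℓ₀ : h₀ ≤ ℓ := le_trans (hh₂ h (by omega)) hℓ
  exact lt_of_le_of_lt (hh₁ h (by omega) ℓ hℓ)
    (hh₀ ℓ hℓ₀ K _ r hx (hasEFOfSize_hull_del ι q hB) (hasEFOfSize_pair_del ι q hEF))

/-- ★★ the localization theorem, budget-aware form. -/
theorem decidedB_loc {X : PClass} (hX : DecidedB X) : DecidedB (Loc X) := by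
  refine decidedB_locAt (s := Nat.sqrt) ?_ ?_ hX
  · intro h₀
    refine ⟨h₀ * h₀, fun h hh => ?_⟩
    have e : Nat.sqrt (h₀ * h₀) = h₀ := Nat.sqrt_eq h₀
    calc h₀ = Nat.sqrt (h₀ * h₀) := e.symm
      _ ≤ Nat.sqrt h := Nat.sqrt_le_sqrt hh
  · intro c
    exact ⟨2 * c, 0, fun h _ ℓ hℓ => T_le_T_double c hℓ⟩

/-- the partition glue, budget-aware form. -/
theorem corVirtualHard_of_residualLawB {X : PClass} (hX : DecidedB X) (hR : ResidualLaw X) : CorVirtualHard := by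
  intro c
  obtain ⟨h₁, hh₁⟩ := hX c
  obtain ⟨h₂, hh₂⟩ := hR c
  refine ⟨h₁ + h₂, fun h hh K q r hB hEF => ?_⟩
  by_cases hq : X h K q
  · exact hh₁ h (by omega) K q r hq hB hEF
  · exact hh₂ h (by omega) K q r hq hB hEF

/-! ## §4 The LOCALIZED residual law reaches `CorVirtualHard` -/

/-- C♭_loc is weaker than C♭: the residual law relative to the localized cone follows from the one relative to the cone. -/
theorem residualLawLoc_of {X : PClass} (hR : ResidualLaw X) : ResidualLaw (Loc X) :=
  residualLaw_mono (fun _ _ _ hq => le_loc X hq) hR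

/-- ★★★ **THE GLUE BY NAME**: a decided cone `X` and the residual law relative to its `√h`-LOCALIZATION give `CorVirtualHard` (hence
stmt-21181 by the line's `nnDivisionHard_of_corVirtual`).  With `X :=` the line's fourteen-fold disjunction this is
`corVirtualHard_of_partition'` with the research stub WEAKENED from `CoreLaw` to its localization. -/
theorem corVirtualHard_of_residualLawLoc {X : PClass} (hX : Decided X) (hR : ResidualLaw (Loc X)) : CorVirtualHard :=
  corVirtualHard_of_residualLaw (decided_loc hX) hR

/-- … and one level deeper (`h^{1/4}`-minors). -/
theorem corVirtualHard_of_residualLawLocLoc {X : PClass} (hX : Decided X) (hR : ResidualLaw (Loc (Loc X))) :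
    CorVirtualHard :=
  corVirtualHard_of_residualLaw (decided_loc_loc hX) hR

/-- budget-aware form of the glue by name. -/
theorem corVirtualHard_of_residualLawLocB {X : PClass} (hX : DecidedB X) (hR : ResidualLaw (Loc X)) : CorVirtualHard :=
  corVirtualHard_of_residualLawB (decidedB_loc hX) hR

/-- **the localized research stub, UNFOLDED** (what the pen pastes as C♭_loc: the fourteen negations move under
«for every deletion minor of size `≥ ⌊√h⌋`»). -/
theorem residualLawLoc_iff (X : PClass) :
    ResidualLaw (Loc X) ↔
      ∀ c : ℕ, ∃ h₀ : ℕ, ∀ h ≥ h₀, ∀ (K : ℕ) (q : Fam h K) (r : ℕ),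
        (∀ ℓ : ℕ, Nat.sqrt h ≤ ℓ → ∀ ι : Fin ℓ ↪ Fin h, ¬ X ℓ K (⇑(delRead ι) ∘ q)) →
        HasEFOfSize (convexHull ℝ (Set.range q)) r →
        HasEFOfSize (corPolytopeGraph (⊤ : SimpleGraph (Fin h)) + convexHull ℝ (Set.range q)) r → T c h < r := by
  unfold ResidualLaw
  simp only [not_loc_iff]

/-- the contrapositive the R-seats use: a cheap budgeted pair BELOW the threshold at a large scale lies outside `X` on every `√h`-minor. -/
theorem enemy_hereditary {X : PClass} (hX : Decided X) (c : ℕ) :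
    ∃ h₀ : ℕ, ∀ h ≥ h₀, ∀ (K : ℕ) (q : Fam h K) (r : ℕ),
      HasEFOfSize (corPolytopeGraph (⊤ : SimpleGraph (Fin h)) + convexHull ℝ (Set.range q)) r → r ≤ T c h →
      ∀ ℓ : ℕ, Nat.sqrt h ≤ ℓ → ∀ ι : Fin ℓ ↪ Fin h, ¬ X ℓ K (⇑(delRead ι) ∘ q) := by
  obtain ⟨h₀, hh₀⟩ := decided_loc hX c
  refine ⟨h₀, fun h hh K q r hEF hr => ?_⟩
  rw [← not_loc_iff]
  intro hq
  exact absurd (hh₀ h hh K q r hq hEF) (not_lt.2 hr)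

/-! ## §5 A sorry-free instance with no class of the line: QUIET CORNERS -/

/-- **CLASS `Quiet`** — constant generator families (the passenger is a point).  `Quiet ⊆ F ⊆ S`, `Quiet ⊆ K`. -/
def Quiet : PClass := fun _ _ q => ∀ j, q j = q 0

theorem hull_range_of_quiet {h K : ℕ} (q : Fam h K) (hq : Quiet h K q) : convexHull ℝ (Set.range q) = {q 0} := by
  have e : Set.range q = {q 0} := by
    ext y
    constructor
    · rintro ⟨j, rfl⟩
      exact hq j
    · rintro rfl
      exact ⟨0, rfl⟩
  rw [e, convexHull_singleton]

/-- `√h ≤ h/2` for `h ≥ 4` (real form). -/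
theorem rpow_half_le_half {h : ℕ} (hh : 4 ≤ h) : (h : ℝ) ^ (1 / 2 : ℝ) ≤ (h : ℝ) / 2 := by
  rw [← Real.sqrt_eq_rpow]
  have h4 : (4 : ℝ) ≤ h := by exact_mod_cast hh
  have hs4 : Real.sqrt 4 = 2 := by
    rw [show (4 : ℝ) = 2 ^ 2 by norm_num, Real.sqrt_sq (by norm_num)]
  have hs : (2 : ℝ) ≤ Real.sqrt h := hs4 ▸ Real.sqrt_le_sqrt h4
  have hm : Real.sqrt h * Real.sqrt h = h := Real.mul_self_sqrt (by positivity)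
  nlinarith [hs, Real.sqrt_nonneg (h : ℝ)]

/-- ★ **`Quiet` is DECIDED** (`COR(K_h)` + point: Kaibel–Weltge `2^{h/2} ≤ r`, then the route threshold). -/
theorem quiet_decided : Decided Quiet := by
  intro c
  obtain ⟨h₀, hh₀⟩ := threshold_lt_of_rpow_bound c (by norm_num : (0 : ℝ) < 1 / 2)
  refine ⟨h₀ + 4, fun h hh K q r hq hEF => ?_⟩
  have h4 : 4 ≤ h := by omega
  rw [hull_range_of_quiet q hq, Set.add_singleton] at hEF
  have hCOR : HasEFOfSize (corPolytopeGraph (⊤ : SimpleGraph (Fin h))) r := by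
    have h1 := hEF.image_add_const (-(q 0))
    rw [Set.image_image] at h1
    simpa using h1
  have hb : (2 : ℝ) ^ ((h : ℝ) / 2) ≤ r := corPolytopeGraph_top_two_pow_half_le h4 hCOR
  have hb' : (2 : ℝ) ^ ((h : ℝ) ^ (1 / 2 : ℝ)) ≤ r :=
    le_trans (Real.rpow_le_rpow_of_exponent_le (by norm_num) (rpow_half_le_half h4)) hb
  exact hh₀ h (by omega) r hb'

/-- ★ **QUIET CORNERS ARE DECIDED**: every passenger family (budgeted or not) that is CONSTANT on some `√h × √h` principal minor makes
`COR(K_h) + conv q` super-quasi-polynomially expensive — whatever it does off the corner. -/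
theorem quietCorner_decided : Decided (Loc Quiet) :=
  decided_loc quiet_decided

/-- the unfolded membership test of `Loc Quiet`. -/
theorem loc_quiet_iff {h K : ℕ} (q : Fam h K) :
    Loc Quiet h K q ↔ ∃ ℓ : ℕ, Nat.sqrt h ≤ ℓ ∧ ∃ ι : Fin ℓ ↪ Fin h, ∀ j (i i' : Fin ℓ), q j (ι i, ι i') = q 0 (ι i, ι i') := by
  unfold Loc LocAt Quiet
  constructor
  · rintro ⟨ℓ, hℓ, ι, hq⟩
    refine ⟨ℓ, hℓ, ι, fun j i i' => ?_⟩
    have := congrFun (hq j) (i, i')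
    exact this
  · rintro ⟨ℓ, hℓ, ι, hq⟩
    refine ⟨ℓ, hℓ, ι, fun j => ?_⟩
    funext ii'
    obtain ⟨i, i'⟩ := ii'
    exact hq j i i'

/-- the residual law relative to quiet corners alone already has the COR-VIRTUAL shape (sanity instance of the glue). -/
example (hR : ResidualLaw (Loc Quiet)) : CorVirtualHard :=
  corVirtualHard_of_residualLaw quietCorner_decided hR

/-! ## §6 DELETION-LOCATED families (crit-9 g2 N20 (P2), typed in the face currency)

A functional `C` valid on `COR(K_h)` whose tight set CONTAINS a whole DELETION FACE `{b : b_{x₀} = 0}` and which has a UNIQUE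
maximising passenger point locates the pair on `Del_{x₀} + {q_{j₀}} ≅ COR(K_{h−1}) + point` — read through the deletion minor
`π_{succAbove x₀}` of §1 and priced by Kaibel–Weltge.  Instances: a UNIQUE MINIMISER OF ONE MATRIX ENTRY among the generators
(`delLocated_of_entryMin`, functional `−E_{xx'}`; this is what kills crit-9's `Q∘` «with one entry»), and the NEGATIVE COLUMN TILT
`W = −Σ_l M_l E_{l x₀}`, `M ≥ 0` (`delLocated_of_colTilt`; N20's «single-column negative tilt» on affine cubes with a tilt-live column).
Mirror image of the line's CLASS W `SwitchLocated` (tight set = the switched face `{b_a = 1}` EXACTLY) under the switching symmetry of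
`COR`; not inside G `DiagFacePoor` (diagonal directions only) nor E♭ (admissible directions vanish on block-constant `b`, which include `𝟙`). -/

/-- **CLASS `DelLocated` — DELETION-LOCATED passenger families.** -/
def DelLocated : PClass := fun h K q =>
  ∃ (x₀ : Fin h) (C : Fin h × Fin h → ℝ) (M : ℝ),
    (∀ b : Fin h → Bool, C ⬝ᵥ corVec (⊤ : SimpleGraph (Fin h)) b ≤ M) ∧
    (∀ b : Fin h → Bool, b x₀ = false → C ⬝ᵥ corVec (⊤ : SimpleGraph (Fin h)) b = M) ∧
      ∃ j₀ : Fin (K + 1), ∀ j, C ⬝ᵥ q j < C ⬝ᵥ q j₀ ∨ q j = q j₀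

/-- the DELETION FACE of `COR(K_h)` at `x₀`: `conv {bbᵀ : b_{x₀} = 0}`. -/
def delFace (h : ℕ) (x₀ : Fin h) : Set (Fin h × Fin h → ℝ) :=
  convexHull ℝ (Set.range fun b : {b : Fin h → Bool // b x₀ = false} => corVec (⊤ : SimpleGraph (Fin h)) b.1)

/-- the single-entry functional `−E_{p₀}`. -/
def negEntry {h : ℕ} (p₀ : Fin h × Fin h) : Fin h × Fin h → ℝ := fun p => if p = p₀ then -1 else 0

theorem negEntry_dotProduct {h : ℕ} (p₀ : Fin h × Fin h) (y : Fin h × Fin h → ℝ) : negEntry p₀ ⬝ᵥ y = -y p₀ := by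
  unfold negEntry dotProduct
  simp [ite_mul, Finset.sum_ite_eq']

/-- the NEGATIVE COLUMN TILT `W = −Σ_l M_l E_{l x₀}` (crit-9 g2 N20). -/
def colTilt {h : ℕ} (x₀ : Fin h) (Mv : Fin h → ℝ) : Fin h × Fin h → ℝ := fun p => if p.2 = x₀ then -(Mv p.1) else 0

theorem colTilt_dotProduct {h : ℕ} (x₀ : Fin h) (Mv : Fin h → ℝ) (y : Fin h × Fin h → ℝ) :
    colTilt x₀ Mv ⬝ᵥ y = -∑ l, Mv l * y (l, x₀) := by
  unfold colTilt dotProduct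
  rw [Fintype.sum_prod_type]
  simp [ite_mul, Finset.sum_ite_eq', Finset.sum_neg_distrib]

theorem corVec_top_apply {h : ℕ} (b : Fin h → Bool) (x x' : Fin h) :
    corVec (⊤ : SimpleGraph (Fin h)) b (x, x') = if (b x && b x') then 1 else 0 := by
  by_cases hx : x = x'
  · subst hx
    rw [corVec_apply_diag, Bool.and_self]
  · exact corVec_apply_adj _ b ((SimpleGraph.top_adj x x').2 hx)

theorem corVec_top_nonneg {h : ℕ} (b : Fin h → Bool) (p : Fin h × Fin h) : 0 ≤ corVec (⊤ : SimpleGraph (Fin h)) b p := by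
  rcases corVec_zero_or_one ⊤ b p with h1 | h1 <;> simp [h1]

theorem corVec_top_eq_zero_of_fst {h : ℕ} (b : Fin h → Bool) {x : Fin h} (x' : Fin h) (hx : b x = false) :
    corVec (⊤ : SimpleGraph (Fin h)) b (x, x') = 0 := by
  rw [corVec_top_apply]; simp [hx]

theorem corVec_top_eq_zero_of_snd {h : ℕ} (b : Fin h → Bool) (x : Fin h) {x' : Fin h} (hx' : b x' = false) :
    corVec (⊤ : SimpleGraph (Fin h)) b (x, x') = 0 := by
  rw [corVec_top_apply]; simp [hx']

/-- ★ **UNIQUE ENTRY MINIMISER ⇒ deletion-located**: if the matrix entry `(x, x')` attains its minimum over the generator list at a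
unique generator POINT, the family is `DelLocated` (functional `−E_{xx'}`, tight on `{b : b_x b_{x'} = 0} ⊇ {b_x = 0}`). -/
theorem delLocated_of_entryMin {h K : ℕ} (q : Fam h K) (x x' : Fin h) (j₀ : Fin (K + 1))
    (hmin : ∀ j, q j₀ (x, x') < q j (x, x') ∨ q j = q j₀) : DelLocated h K q := by
  refine ⟨x, negEntry (x, x'), 0, fun b => ?_, fun b hb => ?_, j₀, fun j => ?_⟩
  · rw [negEntry_dotProduct]
    have := corVec_top_nonneg b (x, x')
    linarith
  · rw [negEntry_dotProduct, corVec_top_eq_zero_of_fst b x' hb]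
    ring
  · rcases hmin j with h1 | h1
    · left
      rw [negEntry_dotProduct, negEntry_dotProduct]
      linarith
    · right
      exact h1

/-- ★ **NEGATIVE COLUMN TILT ⇒ deletion-located** (crit-9 g2 N20 (P2)): `W = −Σ_l M_l E_{l x₀}` with `M ≥ 0` is valid on `COR(K_h)` with
maximum `0`, attained on the whole deletion face `{b_{x₀} = 0}`; a unique `W`-maximising passenger point then locates the pair.  (On an
affine cube `q_P = q_∅ + Σ_{l ∈ P} D_l` whose column `x₀` is TILT-LIVE — every `D_l` has a nonzero entry in column `x₀` — a generic `M ≥ 0`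
makes all `⟨W, D_l⟩ ≠ 0`, hence the maximiser `P* = {l : ⟨W, D_l⟩ > 0}` unique: N20's computation.) -/
theorem delLocated_of_colTilt {h K : ℕ} (q : Fam h K) (x₀ : Fin h) (Mv : Fin h → ℝ) (hM : ∀ l, 0 ≤ Mv l) (j₀ : Fin (K + 1))
    (huniq : ∀ j, colTilt x₀ Mv ⬝ᵥ q j < colTilt x₀ Mv ⬝ᵥ q j₀ ∨ q j = q j₀) : DelLocated h K q := by
  refine ⟨x₀, colTilt x₀ Mv, 0, fun b => ?_, fun b hb => ?_, j₀, huniq⟩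
  · rw [colTilt_dotProduct, neg_nonpos]
    exact Finset.sum_nonneg fun l _ => mul_nonneg (hM l) (corVec_top_nonneg b (l, x₀))
  · rw [colTilt_dotProduct, neg_eq_zero]
    exact Finset.sum_eq_zero fun l _ => by rw [corVec_top_eq_zero_of_snd b l hb, mul_zero]

/-- the passenger part of the exposed face is the unique maximising point. -/
theorem hull_inter_eq_singleton {h K : ℕ} (q : Fam h K) (C : Fin h × Fin h → ℝ) (j₀ : Fin (K + 1))
    (hj : ∀ j, C ⬝ᵥ q j < C ⬝ᵥ q j₀ ∨ q j = q j₀) :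
    convexHull ℝ (Set.range q) ∩ {y | C ⬝ᵥ y = C ⬝ᵥ q j₀} = {q j₀} := by
  have hle : ∀ j, C ⬝ᵥ q j ≤ C ⬝ᵥ q j₀ := fun j => by
    rcases hj j with h1 | h1
    · exact h1.le
    · rw [h1]
  rw [XcDivision.convexHull_range_inter_eq q C _ hle]
  have hr : Set.range (fun j : {j : Fin (K + 1) // C ⬝ᵥ q j = C ⬝ᵥ q j₀} => q j.1) = {q j₀} := by
    ext y
    simp only [Set.mem_range, Set.mem_singleton_iff]
    constructor
    · rintro ⟨⟨j, hj'⟩, rfl⟩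
      rcases hj j with h1 | h1
      · exact absurd hj' h1.ne
      · exact h1
    · rintro rfl
      exact ⟨⟨j₀, rfl⟩, rfl⟩
  rw [hr, convexHull_singleton]

/-- the `COR` part of the exposed face is the hull of the tight vertices. -/
theorem cor_inter_eq {h : ℕ} (C : Fin h × Fin h → ℝ) (M : ℝ) (hC : ∀ b : Fin h → Bool, C ⬝ᵥ corVec (⊤ : SimpleGraph (Fin h)) b ≤ M) :
    corPolytopeGraph (⊤ : SimpleGraph (Fin h)) ∩ {x | C ⬝ᵥ x = M} =
      convexHull ℝ (Set.range fun b : {b : Fin h → Bool // C ⬝ᵥ corVec (⊤ : SimpleGraph (Fin h)) b = M} =>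
        corVec (⊤ : SimpleGraph (Fin h)) b.1) := by
  unfold corPolytopeGraph
  exact XcDivision.convexHull_range_inter_eq _ C M hC

theorem negDiag_corVec_le {h : ℕ} (x₀ : Fin h) (b : Fin h → Bool) :
    negEntry (x₀, x₀) ⬝ᵥ corVec (⊤ : SimpleGraph (Fin h)) b ≤ 0 := by
  rw [negEntry_dotProduct]
  have := corVec_top_nonneg b (x₀, x₀)
  linarith

/-- inside the tight set of `C`, the functional `−E_{x₀x₀}` cuts out exactly the deletion face. -/
theorem corFace_inter_negDiag_eq_delFace {h : ℕ} (x₀ : Fin h) (C : Fin h × Fin h → ℝ) (M : ℝ)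
    (hdel : ∀ b : Fin h → Bool, b x₀ = false → C ⬝ᵥ corVec (⊤ : SimpleGraph (Fin h)) b = M) :
    convexHull ℝ (Set.range fun b : {b : Fin h → Bool // C ⬝ᵥ corVec (⊤ : SimpleGraph (Fin h)) b = M} =>
        corVec (⊤ : SimpleGraph (Fin h)) b.1) ∩ {x | negEntry (x₀, x₀) ⬝ᵥ x = 0} = delFace h x₀ := by
  have hle : ∀ b : {b : Fin h → Bool // C ⬝ᵥ corVec (⊤ : SimpleGraph (Fin h)) b = M},
      negEntry (x₀, x₀) ⬝ᵥ corVec (⊤ : SimpleGraph (Fin h)) b.1 ≤ 0 := fun b => negDiag_corVec_le x₀ b.1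
  rw [XcDivision.convexHull_range_inter_eq _ (negEntry (x₀, x₀)) 0 hle]
  unfold delFace
  congr 1
  ext y
  simp only [Set.mem_range]
  constructor
  · rintro ⟨⟨⟨b, hbM⟩, hb0⟩, rfl⟩
    refine ⟨⟨b, ?_⟩, rfl⟩
    rw [negEntry_dotProduct, corVec_top_apply] at hb0
    cases hx : b x₀
    · rfl
    · simp [hx] at hb0
  · rintro ⟨⟨b, hb⟩, rfl⟩
    refine ⟨⟨⟨b, hdel b hb⟩, ?_⟩, rfl⟩
    show negEntry (x₀, x₀) ⬝ᵥ corVec ⊤ b = 0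
    rw [negEntry_dotProduct, corVec_top_eq_zero_of_fst b x₀ hb]
    ring

/-- ★ the deletion MINOR maps the deletion FACE onto `COR(K_n)` (`§1` restricted to the face, where the read is injective). -/
theorem delRead_image_delFace {n : ℕ} (x₀ : Fin (n + 1)) :
    delRead (Fin.succAboveEmb x₀) '' delFace (n + 1) x₀ = corPolytopeGraph (⊤ : SimpleGraph (Fin n)) := by
  unfold delFace corPolytopeGraph
  rw [LinearMap.image_convexHull, ← Set.range_comp]
  congr 1
  ext y
  constructor
  · rintro ⟨⟨b, hb⟩, rfl⟩
    exact ⟨b ∘ Fin.succAboveEmb x₀, (delRead_corVec _ b).symm⟩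
  · rintro ⟨a, rfl⟩
    refine ⟨⟨Function.extend (Fin.succAboveEmb x₀) a (fun _ => false), ?_⟩, ?_⟩
    · refine Function.extend_apply' _ _ _ ?_
      rintro ⟨i, hi⟩
      exact Fin.succAbove_ne x₀ i hi
    · show delRead _ (corVec ⊤ _) = corVec ⊤ a
      rw [delRead_corVec]
      congr 1
      funext p
      show Function.extend (⇑(Fin.succAboveEmb x₀)) a (fun _ => false) ((Fin.succAboveEmb x₀) p) = a p
      exact (Fin.succAboveEmb x₀).injective.extend_apply _ _ p

/-- `√(n+1) ≤ n/2` for `n ≥ 8`. -/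
theorem rpow_half_succ_le {n : ℕ} (hn : 8 ≤ n) : ((n + 1 : ℕ) : ℝ) ^ (1 / 2 : ℝ) ≤ (n : ℝ) / 2 := by
  rw [← Real.sqrt_eq_rpow]
  have h8 : (8 : ℝ) ≤ n := by exact_mod_cast hn
  have hsq : ((n + 1 : ℕ) : ℝ) ≤ ((n : ℝ) / 2) ^ 2 := by
    push_cast
    nlinarith
  calc Real.sqrt ((n + 1 : ℕ) : ℝ) ≤ Real.sqrt (((n : ℝ) / 2) ^ 2) := Real.sqrt_le_sqrt hsq
    _ = (n : ℝ) / 2 := Real.sqrt_sq (by positivity)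

/-- ★★ **CLASS `DelLocated` IS DECIDED** (two exposed-face cuts `face_add_face₁`, the deletion minor `delRead (succAbove x₀)` of §1,
Kaibel–Weltge on `COR(K_{h−1})`, the route threshold). -/
theorem delLocated_decided : Decided DelLocated := by
  intro c
  obtain ⟨h₀, hh₀⟩ := threshold_lt_of_rpow_bound c (by norm_num : (0 : ℝ) < 1 / 2)
  refine ⟨h₀ + 9, fun h hh K q r hq hEF => ?_⟩
  obtain ⟨x₀, C, M, hCle, hCdel, j₀, hj₀⟩ := hq
  obtain ⟨n, rfl⟩ : ∃ n, h = n + 1 := ⟨h - 1, by omega⟩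
  have hn : 8 ≤ n := by omega
  -- step 1: the exposed face of the pair in direction `C`
  have hP : ∀ x ∈ corPolytopeGraph (⊤ : SimpleGraph (Fin (n + 1))), C ⬝ᵥ x ≤ M := by
    unfold corPolytopeGraph
    refine XcDivision.dot_le_of_mem_convexHull _ C M ?_
    rintro _ ⟨b, rfl⟩
    exact hCle b
  have hle : ∀ j, C ⬝ᵥ q j ≤ C ⬝ᵥ q j₀ := fun j => by
    rcases hj₀ j with h1 | h1
    · exact h1.le
    · rw [h1]
  have hR : ∀ y ∈ convexHull ℝ (Set.range q), C ⬝ᵥ y ≤ C ⬝ᵥ q j₀ :=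
    XcDivision.dot_le_of_mem_convexHull _ C _ (by rintro _ ⟨j, rfl⟩; exact hle j)
  have h1 := hEF.face_add_face₁ C M (C ⬝ᵥ q j₀) hP hR
  rw [hull_inter_eq_singleton q C j₀ hj₀, cor_inter_eq C M hCle] at h1
  -- step 2: the deletion face inside it, direction `−E_{x₀x₀}`
  have hP' : ∀ x ∈ convexHull ℝ (Set.range fun b : {b : Fin (n + 1) → Bool //
      C ⬝ᵥ corVec (⊤ : SimpleGraph (Fin (n + 1))) b = M} => corVec (⊤ : SimpleGraph (Fin (n + 1))) b.1),
      negEntry (x₀, x₀) ⬝ᵥ x ≤ 0 :=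
    XcDivision.dot_le_of_mem_convexHull _ _ _ (by rintro _ ⟨b, rfl⟩; exact negDiag_corVec_le x₀ b.1)
  have hR' : ∀ y ∈ ({q j₀} : Set (Fin (n + 1) × Fin (n + 1) → ℝ)),
      negEntry (x₀, x₀) ⬝ᵥ y ≤ negEntry (x₀, x₀) ⬝ᵥ q j₀ := by
    intro y hy
    rw [Set.mem_singleton_iff.1 hy]
  have h2 := h1.face_add_face₁ (negEntry (x₀, x₀)) 0 (negEntry (x₀, x₀) ⬝ᵥ q j₀) hP' hR'
  rw [corFace_inter_negDiag_eq_delFace x₀ C M hCdel] at h2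
  have hsing : ({q j₀} : Set (Fin (n + 1) × Fin (n + 1) → ℝ)) ∩
      {y | negEntry (x₀, x₀) ⬝ᵥ y = negEntry (x₀, x₀) ⬝ᵥ q j₀} = {q j₀} := by
    ext y
    simp only [Set.mem_inter_iff, Set.mem_singleton_iff, Set.mem_setOf_eq]
    constructor
    · rintro ⟨rfl, -⟩
      rfl
    · rintro rfl
      exact ⟨rfl, rfl⟩
  rw [hsing] at h2
  -- step 3: read the deletion minor at `x₀`
  have h3 := h2.image_linearMap (delRead (Fin.succAboveEmb x₀))
  rw [Set.image_add, delRead_image_delFace, Set.image_singleton] at h3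
  -- step 4: translate the point away; Kaibel–Weltge on `COR(K_n)`
  have hCOR : HasEFOfSize (corPolytopeGraph (⊤ : SimpleGraph (Fin n))) r := by
    rw [Set.add_singleton] at h3
    have h4 := h3.image_add_const (-(delRead (Fin.succAboveEmb x₀) (q j₀)))
    rw [Set.image_image] at h4
    simpa using h4
  have hb : (2 : ℝ) ^ ((n : ℝ) / 2) ≤ r := corPolytopeGraph_top_two_pow_half_le (by omega) hCOR
  have hb' : (2 : ℝ) ^ (((n + 1 : ℕ) : ℝ) ^ (1 / 2 : ℝ)) ≤ r :=
    le_trans (Real.rpow_le_rpow_of_exponent_le (by norm_num) (rpow_half_succ_le hn)) hb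
  exact hh₀ (n + 1) (by omega) r hb'

/-- ★ hence: a unique minimiser of ONE matrix entry among the generators already forces `> T c h`. -/
theorem entryMin_decided :
    Decided (fun h K q => ∃ (x x' : Fin h) (j₀ : Fin (K + 1)), ∀ j, q j₀ (x, x') < q j (x, x') ∨ q j = q j₀) :=
  decided_anti (fun h K q hq => by
    obtain ⟨x, x', j₀, hmin⟩ := hq
    exact delLocated_of_entryMin q x x' j₀ hmin) delLocated_decided

/-- ★ and, by §3, DELETION-LOCATED ON A `√h` CORNER is decided too. -/
theorem delLocatedCorner_decided : Decided (Loc DelLocated) :=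
  decided_loc delLocated_decided

/-- **N21 (enemy side)**: below the threshold, on EVERY deletion minor of size `≥ √h`, NO functional tight on a deletion face has a unique
passenger maximiser — in particular every matrix entry of the read generators attains its minimum at two DISTINCT generator points, and so
does every nonnegative column tilt its maximum. -/
theorem enemy_not_delLocated (c : ℕ) :
    ∃ h₀ : ℕ, ∀ h ≥ h₀, ∀ (K : ℕ) (q : Fam h K) (r : ℕ),
      HasEFOfSize (corPolytopeGraph (⊤ : SimpleGraph (Fin h)) + convexHull ℝ (Set.range q)) r → r ≤ T c h →
      ∀ ℓ : ℕ, Nat.sqrt h ≤ ℓ → ∀ ι : Fin ℓ ↪ Fin h, ¬ DelLocated ℓ K (⇑(delRead ι) ∘ q) :=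
  enemy_hereditary delLocated_decided c

/-! ## §7 SWITCHING: every decided class is closed under the switching symmetry of `COR(K_h)` — a second free functor, at NO cost in scale

The switching `σ_a` at vertex `a` (`b ↦ b` with coordinate `a` flipped) is an AFFINE AUTOMORPHISM of `COR(K_h)`: `σ_a(x) = L_a x + E_{aa}` with
the linear part `L_a` below (`x_{aa} ↦ −x_{aa}`, `x_{ia} ↦ x_{ii} − x_{ia}`, `x_{aj} ↦ x_{jj} − x_{aj}`, other entries fixed).  Hence
`xc(COR + conv q) = xc(σ_a(COR + conv q)) = xc(COR + conv(L_a q))`: reading the PASSENGER through `L_a` costs nothing, and for any class `X`,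
`Decided X → Decided (Sw X)` with `Sw X h q :≡ ∃ a, X h (L_a ∘ q)` and the SAME threshold (no currency exchange, unlike §3).  With §3 this gives
the pen the orbit calculus «decided ⇒ decided on every √h minor AND after every switching» for all fifteen classes by ONE theorem each, and the
enemy reading N22 (`enemy_not_sw`).  (CLASS W `SwitchLocated` of rev 17 is, up to the adjoint `L_aᵀ` on the functional, the `Sw`-image of the
exact-tightness variant of §6's `DelLocated`; we do not type that dictionary here.) -/

/-- flip coordinate `a`. -/
def flipAt {h : ℕ} (a : Fin h) (b : Fin h → Bool) : Fin h → Bool := Function.update b a (!b a)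

theorem flipAt_apply_self {h : ℕ} (a : Fin h) (b : Fin h → Bool) : flipAt a b a = !b a := by
  simp [flipAt]

theorem flipAt_apply_ne {h : ℕ} (a : Fin h) (b : Fin h → Bool) {i : Fin h} (hi : i ≠ a) : flipAt a b i = b i := by
  simp [flipAt, hi]

theorem flipAt_flipAt {h : ℕ} (a : Fin h) (b : Fin h → Bool) : flipAt a (flipAt a b) = b := by
  funext i
  by_cases hi : i = a
  · subst hi; rw [flipAt_apply_self, flipAt_apply_self, Bool.not_not]
  · rw [flipAt_apply_ne a _ hi, flipAt_apply_ne a _ hi]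

/-- the LINEAR PART of the switching of `COR(K_h)` at vertex `a`. -/
def swLin {h : ℕ} (a : Fin h) : (Fin h × Fin h → ℝ) →ₗ[ℝ] (Fin h × Fin h → ℝ) where
  toFun x := fun p =>
    if p.1 = a ∧ p.2 = a then -x (a, a)
    else if p.2 = a then x (p.1, p.1) - x p
    else if p.1 = a then x (p.2, p.2) - x p
    else x p
  map_add' := by
    intro x y; funext p; simp only [Pi.add_apply]; split_ifs <;> ring
  map_smul' := by
    intro c x; funext p; simp only [Pi.smul_apply, smul_eq_mul, RingHom.id_apply]; split_ifs <;> ring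

theorem swLin_apply {h : ℕ} (a : Fin h) (x : Fin h × Fin h → ℝ) (p : Fin h × Fin h) :
    swLin a x p = (if p.1 = a ∧ p.2 = a then -x (a, a)
      else if p.2 = a then x (p.1, p.1) - x p
      else if p.1 = a then x (p.2, p.2) - x p
      else x p) := rfl

/-- `E_{aa}`. -/
def diagUnit {h : ℕ} (a : Fin h) : Fin h × Fin h → ℝ := fun p => if p = (a, a) then 1 else 0

/-- ★ the switching acts on the vertices of `COR(K_h)`: `L_a (bbᵀ) + E_{aa} = b'b'ᵀ`, `b' = b` with coordinate `a` flipped. -/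
theorem swLin_corVec {h : ℕ} (a : Fin h) (b : Fin h → Bool) :
    swLin a (corVec (⊤ : SimpleGraph (Fin h)) b) + diagUnit a = corVec (⊤ : SimpleGraph (Fin h)) (flipAt a b) := by
  funext p
  obtain ⟨i, j⟩ := p
  simp only [Pi.add_apply, swLin_apply, corVec_top_apply, diagUnit, Prod.mk.injEq]
  by_cases hi : i = a <;> by_cases hj : j = a
  · rw [hi, hj]
    simp only [and_self, if_true, flipAt_apply_self]
    cases b a <;> simp
  · rw [hi]
    simp only [hj, and_false, if_false, if_true, flipAt_apply_self, flipAt_apply_ne a b hj]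
    cases b a <;> cases b j <;> simp
  · rw [hj]
    simp only [hi, false_and, if_false, if_true, flipAt_apply_self, flipAt_apply_ne a b hi]
    cases b a <;> cases b i <;> simp
  · simp only [hi, hj, and_self, if_false, flipAt_apply_ne a b hi, flipAt_apply_ne a b hj]
    simp

/-- ★ `L_a(COR(K_h)) + E_{aa} = COR(K_h)`: the switching is an affine automorphism of the correlation polytope. -/
theorem swLin_image_cor_add {h : ℕ} (a : Fin h) :
    swLin a '' corPolytopeGraph (⊤ : SimpleGraph (Fin h)) + {diagUnit a} = corPolytopeGraph (⊤ : SimpleGraph (Fin h)) := by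
  unfold corPolytopeGraph
  rw [LinearMap.image_convexHull, ← Set.range_comp, ← convexHull_singleton (𝕜 := ℝ) (diagUnit a), ← convexHull_add,
    Set.add_singleton, ← Set.range_comp]
  congr 1
  ext y
  constructor
  · rintro ⟨b, rfl⟩
    exact ⟨flipAt a b, by simp only [Function.comp]; rw [swLin_corVec]⟩
  · rintro ⟨b, rfl⟩
    refine ⟨flipAt a b, ?_⟩
    simp only [Function.comp]
    rw [swLin_corVec, flipAt_flipAt]


/-- the SWITCHED class: the passenger read through one switching `L_a`. -/
def Sw (X : PClass) : PClass := fun h K q => ∃ a : Fin h, X h K (⇑(swLin a) ∘ q)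

/-- ★ TRANSPORT: an EF of the pair is an EF of the switched pair (same size). -/
theorem hasEFOfSize_pair_sw {h K : ℕ} (a : Fin h) (q : Fam h K) {r : ℕ}
    (hEF : HasEFOfSize (corPolytopeGraph (⊤ : SimpleGraph (Fin h)) + convexHull ℝ (Set.range q)) r) :
    HasEFOfSize (corPolytopeGraph (⊤ : SimpleGraph (Fin h)) + convexHull ℝ (Set.range (⇑(swLin a) ∘ q))) r := by
  have h1 := (hEF.image_linearMap (swLin a)).image_add_const (diagUnit a)
  rw [Set.image_add, LinearMap.image_convexHull, ← Set.range_comp, ← Set.add_singleton, add_right_comm,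
    swLin_image_cor_add] at h1
  exact h1

theorem hasEFOfSize_hull_sw {h K : ℕ} (a : Fin h) (q : Fam h K) {r : ℕ}
    (hEF : HasEFOfSize (convexHull ℝ (Set.range q)) r) :
    HasEFOfSize (convexHull ℝ (Set.range (⇑(swLin a) ∘ q))) r := by
  have h1 := hEF.image_linearMap (swLin a)
  rwa [LinearMap.image_convexHull, ← Set.range_comp] at h1

/-- ★★ **SWITCHING THEOREM.** `Decided X → Decided (Sw X)`, same threshold. -/
theorem decided_sw {X : PClass} (hX : Decided X) : Decided (Sw X) := by
  intro c
  obtain ⟨h₀, H⟩ := hX c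
  refine ⟨h₀, fun h hh K q r hq hEF => ?_⟩
  obtain ⟨a, ha⟩ := hq
  exact H h hh K _ r ha (hasEFOfSize_pair_sw a q hEF)

/-- budgeted version. -/
theorem decidedB_sw {X : PClass} (hX : DecidedB X) : DecidedB (Sw X) := by
  intro c
  obtain ⟨h₀, H⟩ := hX c
  refine ⟨h₀, fun h hh K q r hq hB hEF => ?_⟩
  obtain ⟨a, ha⟩ := hq
  exact H h hh K _ r ha (hasEFOfSize_hull_sw a q hB) (hasEFOfSize_pair_sw a q hEF)

/-- the ORBIT STEP of a class: as read, or after one switching, on a `√h` deletion minor. -/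
def Orb (X : PClass) : PClass := Loc (fun h K q => X h K q ∨ Sw X h K q)

theorem decided_orb {X : PClass} (hX : Decided X) : Decided (Orb X) :=
  decided_loc (decided_or hX (decided_sw hX))

theorem le_orb {X : PClass} {h K : ℕ} {q : Fam h K} (hq : X h K q) : Orb X h K q :=
  le_loc (fun h K q => X h K q ∨ Sw X h K q) (Or.inl hq)

/-- ★★★ **GLUE (orbit form).**  For the pen: with `X := Decided₁₅` (the disjunction of the fifteen decided classes) it suffices to prove the
residual law on families that are residual AS READ, AFTER EVERY SWITCHING, ON EVERY `√h` DELETION MINOR. -/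
theorem corVirtualHard_of_residualLawOrb {X : PClass} (hX : Decided X) (hR : ResidualLaw (Orb X)) : CorVirtualHard :=
  corVirtualHard_of_residualLaw (decided_orb hX) hR

/-- **N22 (enemy side)**: below the threshold, no switching of the passenger (read on any `√h` minor) lands in a decided class. -/
theorem enemy_not_sw {X : PClass} (hX : Decided X) (c : ℕ) :
    ∃ h₀ : ℕ, ∀ h ≥ h₀, ∀ (K : ℕ) (q : Fam h K) (r : ℕ),
      HasEFOfSize (corPolytopeGraph (⊤ : SimpleGraph (Fin h)) + convexHull ℝ (Set.range q)) r → r ≤ T c h →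
      ∀ ℓ : ℕ, Nat.sqrt h ≤ ℓ → ∀ ι : Fin ℓ ↪ Fin h, ∀ a : Fin ℓ, ¬ X ℓ K (⇑(swLin a) ∘ (⇑(delRead ι) ∘ q)) := by
  obtain ⟨h₀, hh₀⟩ := enemy_hereditary (decided_sw hX) c
  refine ⟨h₀, fun h hh K q r hEF hr ℓ hℓ ι a hq => hh₀ h hh K q r hEF hr ℓ hℓ ι ⟨a, hq⟩⟩

/-- e.g. switched deletion-located families are decided (functional tight on a SWITCHED deletion face `{b_{x₀} = 1}`-type configurations). -/
theorem swDelLocated_decided : Decided (Sw DelLocated) := decided_sw delLocated_decided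

/-! ## §8 THE DIAGONAL PERMUTAHEDRON `Q^Π_λ` IS IN `Sw DelLocated` — decided in face currency (crit-9 g2 22:52:44Z, «the open question of wave 6»)

`Q^Π_λ = conv{−λ·diag(π) : π ∈ S_h}` (Goemans: xc `O(h log h)`).  After the switching at any vertex `a`, the passenger point `L_a q_π` carries
the diagonal in COLUMN `a` (`(L_a q_π)_{ia} = (q_π)_{ii} = −λ(π(i)+1)`), and N20's NEGATIVE COLUMN TILT `W = −Σ_l ω(l) E_{l a}` with `ω` a
bijection `Fin h → {0,…,h−1}`, `ω(a) = 0`, evaluates to `λ Σ_l ω(l)(π(l)+1)` — UNIQUELY maximised at `π = ω` by the square identity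
`Σ ω_l π_l = Σ_k k² − ½ Σ_l (ω_l − π_l)²`.  Hence `Q^Π_λ ∈ Sw DelLocated` (`qPerm_swDelLocated`) and ★★ `diagPermutahedron_decided`: in xc /
face currency `Q^Π_λ` is NOT an enemy — `xc(COR(K_h) + Q^Π_λ) > T c h`.  Unswitched, the same certificate is the functional
`C = M·E_{aa} + Σ_{i≠a} ω(i)(E_{ia} − E_{ii})` (valid on `COR`, max `M` iff `b_a = 1`, unique maximising permutation `ω`): `Q^Π_λ` is literally in
CLASS W `SwitchLocated` of LINE rev 17 as well (paper; three lines).  LAW-CURRENCY READING (paper, for crit-9's `M_{a,σ}` question): these are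
located rows `(a′, C)` at the SWITCHED face `{b_a = 1}`; with EXACT rhs (`pinnedRows`, S = {a}) their slack on the window `{b ∋ a} × {ω}` is
`(1 − |a′∩b|)²` = UDISJ_{h−1} (so exact-rhs located pencils DECIDE `Q^Π`); with BOX rhs (`entryTilted` = C⁺_entry literal) the off-diagonal
entries `+ω(i)E_{ia}` add the constant `D = Σ_{i≠a} ω(i) = h(h−1)/2 ≥ h − 1` on the window and `(1−t)² + D = (D+1−t) + t(t−1)` has nonneg rank
`≤ (2h+1) + h²` — box-blind, consistent with crit-9's reduction of C⁺_entry-blindness of `Q^Π` to `rank₊ M_{a,σ}`. -/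

/-- the diagonal permutation passenger point `q_π = −λ·diag(π(i)+1)`. -/
def qPerm {h : ℕ} (lam : ℝ) (π : Equiv.Perm (Fin h)) : Fin h × Fin h → ℝ :=
  fun p => if p.1 = p.2 then -(lam * (((π p.1 : ℕ) : ℝ) + 1)) else 0

theorem swLin_qPerm_col {h : ℕ} (a : Fin h) (lam : ℝ) (π : Equiv.Perm (Fin h)) (l : Fin h) :
    swLin a (qPerm lam π) (l, a) =
      if l = a then lam * (((π a : ℕ) : ℝ) + 1) else -(lam * (((π l : ℕ) : ℝ) + 1)) := by
  rw [swLin_apply]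
  unfold qPerm
  by_cases hl : l = a
  · simp [hl]
  · simp [hl]

/-- the column tilt `−Σ_l ω(l) E_{la}` evaluated on the switched permutation point. -/
theorem colTilt_sw_qPerm {h : ℕ} (a : Fin h) (ω : Equiv.Perm (Fin h)) (hωa : ((ω a : ℕ) : ℝ) = 0) (lam : ℝ)
    (π : Equiv.Perm (Fin h)) :
    colTilt a (fun l => ((ω l : ℕ) : ℝ)) ⬝ᵥ swLin a (qPerm lam π) =
      lam * ∑ l, ((ω l : ℕ) : ℝ) * (((π l : ℕ) : ℝ) + 1) := by
  rw [colTilt_dotProduct, Finset.mul_sum, ← Finset.sum_neg_distrib]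
  refine Finset.sum_congr rfl fun l _ => ?_
  rw [swLin_qPerm_col]
  by_cases hl : l = a
  · subst hl
    rw [if_pos rfl, hωa]
    ring
  · rw [if_neg hl]
    ring

theorem sum_sq_perm {h : ℕ} (π : Equiv.Perm (Fin h)) :
    ∑ l, (((π l : ℕ) : ℝ)) ^ 2 = ∑ l : Fin h, ((l : ℕ) : ℝ) ^ 2 :=
  Equiv.sum_comp π (fun k : Fin h => ((k : ℕ) : ℝ) ^ 2)

/-- ★ the square identity: `Σ ω_l π_l < Σ ω_l²` for permutations `π ≠ ω`. -/
theorem sum_mul_perm_lt {h : ℕ} (ω π : Equiv.Perm (Fin h)) (hne : π ≠ ω) :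
    ∑ l, ((ω l : ℕ) : ℝ) * ((π l : ℕ) : ℝ) < ∑ l, ((ω l : ℕ) : ℝ) * ((ω l : ℕ) : ℝ) := by
  have hsq : 0 < ∑ l, (((ω l : ℕ) : ℝ) - ((π l : ℕ) : ℝ)) ^ 2 := by
    obtain ⟨l₀, hl₀⟩ : ∃ l, π l ≠ ω l := by
      by_contra hcon
      push Not at hcon
      exact hne (Equiv.ext hcon)
    refine Finset.sum_pos' (fun l _ => sq_nonneg _) ⟨l₀, Finset.mem_univ _, ?_⟩
    have hd : ((ω l₀ : ℕ) : ℝ) - ((π l₀ : ℕ) : ℝ) ≠ 0 := by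
      intro h0
      apply hl₀
      have : ((π l₀ : ℕ) : ℝ) = ((ω l₀ : ℕ) : ℝ) := by linarith
      exact Fin.ext (by exact_mod_cast this)
    rw [pow_two]
    exact mul_self_pos.2 hd
  have hexp : ∀ l : Fin h, (((ω l : ℕ) : ℝ) - ((π l : ℕ) : ℝ)) ^ 2 =
      ((ω l : ℕ) : ℝ) ^ 2 - 2 * (((ω l : ℕ) : ℝ) * ((π l : ℕ) : ℝ)) + ((π l : ℕ) : ℝ) ^ 2 := fun l => by ring
  simp only [hexp, Finset.sum_add_distrib, Finset.sum_sub_distrib, ← Finset.mul_sum] at hsq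
  rw [sum_sq_perm π, ← sum_sq_perm ω] at hsq
  have h2 : ∑ l, ((ω l : ℕ) : ℝ) * ((ω l : ℕ) : ℝ) = ∑ l, ((ω l : ℕ) : ℝ) ^ 2 :=
    Finset.sum_congr rfl fun l _ => by ring
  rw [h2]
  linarith

/-- ★★ `Q^Π_λ ∈ Sw DelLocated`: for any listing `e` of permutations containing some `ω` with `ω(a) = 0`. -/
theorem qPerm_swDelLocated {h K : ℕ} (lam : ℝ) (hlam : 0 < lam) (a : Fin h) (ω : Equiv.Perm (Fin h))
    (hωa : (ω a : ℕ) = 0) (e : Fin (K + 1) → Equiv.Perm (Fin h)) (j₀ : Fin (K + 1)) (hj₀ : e j₀ = ω) :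
    Sw DelLocated h K (fun j => qPerm lam (e j)) := by
  have hωa' : ((ω a : ℕ) : ℝ) = 0 := by exact_mod_cast hωa
  refine ⟨a, delLocated_of_colTilt _ a (fun l => ((ω l : ℕ) : ℝ)) (fun l => by positivity) j₀ fun j => ?_⟩
  by_cases hj : e j = ω
  · right
    simp only [Function.comp_apply, hj, hj₀]
  · left
    simp only [Function.comp_apply]
    rw [colTilt_sw_qPerm a ω hωa', colTilt_sw_qPerm a ω hωa', hj₀]
    refine mul_lt_mul_of_pos_left ?_ hlam
    have hlt := sum_mul_perm_lt ω (e j) hj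
    have hω : ∑ l, ((ω l : ℕ) : ℝ) * (((ω l : ℕ) : ℝ) + 1) = ∑ l, ((ω l : ℕ) : ℝ) * ((ω l : ℕ) : ℝ) + ∑ l, ((ω l : ℕ) : ℝ) := by
      rw [← Finset.sum_add_distrib]
      exact Finset.sum_congr rfl fun l _ => by ring
    have hπ : ∑ l, ((ω l : ℕ) : ℝ) * (((e j l : ℕ) : ℝ) + 1) = ∑ l, ((ω l : ℕ) : ℝ) * ((e j l : ℕ) : ℝ) + ∑ l, ((ω l : ℕ) : ℝ) := by
      rw [← Finset.sum_add_distrib]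
      exact Finset.sum_congr rfl fun l _ => by ring
    rw [hω, hπ]
    linarith

/-- ★★★ **THE DIAGONAL PERMUTAHEDRON IS DECIDED (face / xc currency).**  For every `λ > 0` and every listing of `S_h` onto the passenger index:
`xc(COR(K_h) + Q^Π_λ) > T c h` for `h ≥ h₀(c)` — by §7 (switch at vertex `0`) + §6 (column tilt `−Σ_l l·E_{l0}`, unique maximiser `π = id`). -/
theorem diagPermutahedron_decided (lam : ℝ) (hlam : 0 < lam) :
    ∀ c : ℕ, ∃ h₀ : ℕ, ∀ h ≥ h₀, ∀ (K : ℕ) (e : Fin (K + 1) → Equiv.Perm (Fin h)), Function.Surjective e → ∀ r : ℕ,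
      HasEFOfSize (corPolytopeGraph (⊤ : SimpleGraph (Fin h)) + convexHull ℝ (Set.range fun j => qPerm lam (e j))) r →
      T c h < r := by
  intro c
  obtain ⟨h₀, H⟩ := swDelLocated_decided c
  refine ⟨h₀ + 1, fun h hh K e he r hEF => H h (by omega) K _ r ?_ hEF⟩
  have hpos : 0 < h := by omega
  obtain ⟨j₀, hj₀⟩ := he (Equiv.refl _)
  exact qPerm_swDelLocated lam hlam ⟨0, hpos⟩ (Equiv.refl _) (by simp) e j₀ hj₀

/-! ### §8b … and `Q^Π_λ` is literally in CLASS W (`SwitchExposed`, ✓ landed `Theorems/FifoMatchingNNDivisionHardSwitchedFaceTower`):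
the unswitched certificate `C = E_{aa} + Σ_{i≠a} ω(i)(E_{ia} − E_{ii})`, decided BY NAME via `SwitchFace.switchExposed_three_pow_le` -/

/-- the unit entry functional `E_{p₀}`. -/
def unitEntry {h : ℕ} (p₀ : Fin h × Fin h) : Fin h × Fin h → ℝ := fun p => if p = p₀ then 1 else 0

theorem unitEntry_dotProduct {h : ℕ} (p₀ : Fin h × Fin h) (y : Fin h × Fin h → ℝ) : unitEntry p₀ ⬝ᵥ y = y p₀ := by
  unfold unitEntry dotProduct
  simp [ite_mul, Finset.sum_ite_eq']

/-- the diagonal functional `Σ_l w(l) E_{ll}`. -/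
def diagW {h : ℕ} (w : Fin h → ℝ) : Fin h × Fin h → ℝ := fun p => if p.2 = p.1 then w p.1 else 0

theorem diagW_dotProduct {h : ℕ} (w : Fin h → ℝ) (y : Fin h × Fin h → ℝ) : diagW w ⬝ᵥ y = ∑ l, w l * y (l, l) := by
  unfold diagW dotProduct
  rw [Fintype.sum_prod_type]
  refine Finset.sum_congr rfl fun l _ => ?_
  simp [ite_mul, Finset.sum_ite_eq']

/-- the SWITCHED-FACE certificate for the diagonal permutahedron: `C = E_{aa} + Σ_l ω(l) E_{la} − Σ_l ω(l) E_{ll}`. -/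
def permSwitchFun {h : ℕ} (a : Fin h) (ω : Fin h → ℝ) : Fin h × Fin h → ℝ :=
  unitEntry (a, a) - colTilt a ω - diagW ω

theorem permSwitchFun_dotProduct {h : ℕ} (a : Fin h) (ω : Fin h → ℝ) (y : Fin h × Fin h → ℝ) :
    permSwitchFun a ω ⬝ᵥ y = y (a, a) + ∑ l, ω l * y (l, a) - ∑ l, ω l * y (l, l) := by
  unfold permSwitchFun
  rw [sub_dotProduct, sub_dotProduct, unitEntry_dotProduct, colTilt_dotProduct, diagW_dotProduct]
  ring

theorem permSwitchFun_corVec {h : ℕ} (a : Fin h) (ω : Fin h → ℝ) (b : Fin h → Bool) :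
    permSwitchFun a ω ⬝ᵥ corVec (⊤ : SimpleGraph (Fin h)) b =
      if b a then 1 else -∑ l, ω l * (if b l then 1 else 0) := by
  rw [permSwitchFun_dotProduct]
  simp only [corVec_top_apply, Bool.and_self]
  cases hba : b a
  · simp
  · simp

theorem permSwitchFun_qPerm {h : ℕ} (a : Fin h) (ω : Fin h → ℝ) (hωa : ω a = 0) (lam : ℝ) (π : Equiv.Perm (Fin h)) :
    permSwitchFun a ω ⬝ᵥ qPerm lam π =
      -(lam * (((π a : ℕ) : ℝ) + 1)) + lam * ∑ l, ω l * (((π l : ℕ) : ℝ) + 1) := by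
  rw [permSwitchFun_dotProduct]
  have hcol : ∑ l, ω l * qPerm lam π (l, a) = 0 := by
    refine Finset.sum_eq_zero fun l _ => ?_
    by_cases hl : l = a
    · subst hl
      rw [hωa, zero_mul]
    · unfold qPerm
      rw [if_neg hl, mul_zero]
  rw [hcol, add_zero]
  have hdiag : ∑ l, ω l * qPerm lam π (l, l) = -(lam * ∑ l, ω l * (((π l : ℕ) : ℝ) + 1)) := by
    rw [Finset.mul_sum, ← Finset.sum_neg_distrib]
    refine Finset.sum_congr rfl fun l _ => ?_
    unfold qPerm
    rw [if_pos rfl]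
    ring
  have haa : qPerm lam π (a, a) = -(lam * (((π a : ℕ) : ℝ) + 1)) := by
    unfold qPerm
    rw [if_pos rfl]
  rw [hdiag, haa]
  ring

open Summit.ValiantsHypothesis.ValiantsHypothesis.Theorems.FifoMatching (SwitchFace.SwitchExposed SwitchFace.switchExposed_three_pow_le) in
/-- ★★ `Q^Π_λ ∈ CLASS W` (`SwitchExposed`, h = n + 1): switched face at `a = 0`, `ω = id`. -/
theorem qPerm_switchExposed (n K : ℕ) (lam : ℝ) (hlam : 0 < lam) (e : Fin (K + 1) → Equiv.Perm (Fin (n + 1)))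
    (j₀ : Fin (K + 1)) (hj₀ : e j₀ = Equiv.refl _) :
    SwitchFace.SwitchExposed n (fun j => qPerm lam (e j)) := by
  refine ⟨0, permSwitchFun 0 (fun l => ((l : ℕ) : ℝ)), 1, fun b => ?_, fun b => ?_, j₀, fun j => ?_⟩
  · rw [permSwitchFun_corVec]
    split_ifs
    · exact le_rfl
    · have : 0 ≤ ∑ l : Fin (n + 1), ((l : ℕ) : ℝ) * (if b l then 1 else 0) :=
        Finset.sum_nonneg fun l _ => mul_nonneg (by positivity) (by split_ifs <;> norm_num)
      linarith
  · rw [permSwitchFun_corVec]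
    constructor
    · intro hb
      by_contra hba
      rw [if_neg hba] at hb
      have : 0 ≤ ∑ l : Fin (n + 1), ((l : ℕ) : ℝ) * (if b l then 1 else 0) :=
        Finset.sum_nonneg fun l _ => mul_nonneg (by positivity) (by split_ifs <;> norm_num)
      linarith
    · intro hba
      rw [if_pos hba]
  · by_cases hj : e j = Equiv.refl _
    · right
      simp only [hj, hj₀]
    · left
      have h0 : ((fun l : Fin (n + 1) => ((l : ℕ) : ℝ)) 0) = 0 := by simp
      simp only
      rw [permSwitchFun_qPerm 0 _ h0 lam (e j), permSwitchFun_qPerm 0 _ h0 lam (e j₀), hj₀]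
      have hlt := sum_mul_perm_lt (Equiv.refl _) (e j) hj
      simp only [Equiv.refl_apply] at hlt ⊢
      have hπ : ∑ l : Fin (n + 1), ((l : ℕ) : ℝ) * (((e j l : ℕ) : ℝ) + 1) =
          ∑ l : Fin (n + 1), ((l : ℕ) : ℝ) * ((e j l : ℕ) : ℝ) + ∑ l : Fin (n + 1), ((l : ℕ) : ℝ) := by
        rw [← Finset.sum_add_distrib]
        exact Finset.sum_congr rfl fun l _ => by ring
      have hω : ∑ l : Fin (n + 1), ((l : ℕ) : ℝ) * (((l : ℕ) : ℝ) + 1) =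
          ∑ l : Fin (n + 1), ((l : ℕ) : ℝ) * ((l : ℕ) : ℝ) + ∑ l : Fin (n + 1), ((l : ℕ) : ℝ) := by
        rw [← Finset.sum_add_distrib]
        exact Finset.sum_congr rfl fun l _ => by ring
      rw [hπ, hω]
      have hpa : (0 : ℝ) ≤ ((e j 0 : ℕ) : ℝ) := by positivity
      simp only [Fin.val_zero, CharP.cast_eq_zero, zero_add, mul_one]
      nlinarith [hlt, hpa, hlam]

open Summit.ValiantsHypothesis.ValiantsHypothesis.Theorems.FifoMatching (SwitchFace.SwitchExposed SwitchFace.switchExposed_three_pow_le) in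
/-- ★★★ hence, BY NAME from the landed engine of CLASS W: `xc(COR(K_{n+1}) + Q^Π_λ) ≥ (3/2)^n − 1` — LINE rev 17 already decides `Q^Π`. -/
theorem diagPermutahedron_three_pow_le (n K : ℕ) (lam : ℝ) (hlam : 0 < lam) (e : Fin (K + 1) → Equiv.Perm (Fin (n + 1)))
    (he : Function.Surjective e) (r : ℕ)
    (hEF : HasEFOfSize (corPolytopeGraph (⊤ : SimpleGraph (Fin (n + 1))) +
      convexHull ℝ (Set.range fun j => qPerm lam (e j))) r) :
    3 ^ n ≤ (r + 1) * 2 ^ n := by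
  obtain ⟨j₀, hj₀⟩ := he (Equiv.refl _)
  exact SwitchFace.switchExposed_three_pow_le n K _ r (qPerm_switchExposed n K lam hlam e j₀ hj₀) hEF

/-! ## §9 THE PAIR SIEVE — class membership read off the VERTEX LIST (N23 in kernel, pair version)

A passenger is DECIDED as soon as ONE column `x₀` separates its distinct vertices (`ColSep ⊆ DelLocated`: a generic
NONNEGATIVE column tilt along the moment curve `ω_l = t^l` has a unique optimal passenger vertex — `exists_nonneg_separating`,
`delLocated_of_colSep`), or ONE SWITCHED column does (`SwitchSep ⊆ Sw ColSep`: the data `(q_j(a,a), (q_j(l,l) − q_j(l,a))_{l≠a})`,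
`sw_colSep_of_switchSep`); by §3/§7 the same on every `√h` principal minor and after every switching (`orb_colSep_decided`).
ENEMY READING (N23): a `C♭`-candidate must have, for EVERY `x₀`, two distinct vertices sharing the whole column `x₀`, and for
EVERY `a`, two distinct vertices sharing the switched column — and this on every large minor; `Q^Π_λ` fails it at every `a`
(`qPerm_switchSep`: third, sieve-level exclusion of the diagonal permutahedron). -/


open Polynomial in
/-- ★ GENERIC NONNEGATIVE WEIGHTS (moment curve): finitely many vectors are pairwise separated by ONE nonnegative weight
vector — `ω_l = t^l` with `t` beyond every root of the (nonzero) difference polynomials `Σ_l (v_j(l) − v_k(l)) X^l`. -/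
theorem exists_nonneg_separating {m J : ℕ} (v : Fin J → Fin m → ℝ) :
    ∃ ω : Fin m → ℝ, (∀ l, 0 ≤ ω l) ∧ ∀ j k, v j ≠ v k → ω ⬝ᵥ v j ≠ ω ⬝ᵥ v k := by
  classical
  let P : Fin J → Fin J → ℝ[X] := fun j k => ∑ l : Fin m, C (v j l - v k l) * X ^ (l : ℕ)
  have hcoeff : ∀ j k (l : Fin m), (P j k).coeff l = v j l - v k l := by
    intro j k l
    simp only [P, finsetSum_coeff, coeff_C_mul, coeff_X_pow]
    rw [Finset.sum_eq_single l]
    · simp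
    · intro l' _ hl'
      rw [if_neg (fun h => hl' (Fin.ext h).symm), mul_zero]
    · intro h; exact absurd (Finset.mem_univ l) h
  have hP : ∀ j k, v j ≠ v k → P j k ≠ 0 := by
    intro j k hne hzero
    apply hne
    funext l
    have := hcoeff j k l
    rw [hzero, coeff_zero] at this
    linarith
  have heval : ∀ j k (t : ℝ), (P j k).eval t = ∑ l : Fin m, (v j l - v k l) * t ^ (l : ℕ) := by
    intro j k t
    simp only [P, eval_finsetSum, eval_mul, eval_C, eval_pow, eval_X]
  let B : Finset ℝ := Finset.univ.biUnion fun jk : Fin J × Fin J => (P jk.1 jk.2).roots.toFinset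
  let t : ℝ := 1 + ∑ x ∈ B, |x|
  have hB0 : 0 ≤ ∑ x ∈ B, |x| := Finset.sum_nonneg fun x _ => abs_nonneg x
  have htB : t ∉ B := by
    intro ht
    have h1 : |t| ≤ ∑ x ∈ B, |x| := Finset.single_le_sum (f := fun x => |x|) (fun x _ => abs_nonneg x) ht
    have h2 : t ≤ ∑ x ∈ B, |x| := le_trans (le_abs_self t) h1
    simp only [t] at h2
    linarith
  refine ⟨fun l => t ^ (l : ℕ), fun l => by positivity, fun j k hne heq => htB ?_⟩
  rw [Finset.mem_biUnion]
  refine ⟨(j, k), Finset.mem_univ _, ?_⟩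
  rw [Multiset.mem_toFinset, mem_roots (hP j k hne), IsRoot.def, heval]
  have hsplit : ∑ l : Fin m, (v j l - v k l) * t ^ (l : ℕ) =
      (∑ l : Fin m, t ^ (l : ℕ) * v j l) - ∑ l : Fin m, t ^ (l : ℕ) * v k l := by
    rw [← Finset.sum_sub_distrib]
    exact Finset.sum_congr rfl fun l _ => by ring
  rw [hsplit]
  simp only [dotProduct] at heq
  rw [heq, sub_self]

/-- CLASS `ColSep`: some column `x₀` of the passenger points separates distinct points. -/
def ColSep : PClass := fun h K q => ∃ x₀ : Fin h, ∀ j k, (∀ l, q j (l, x₀) = q k (l, x₀)) → q j = q k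

/-- ★★ `ColSep ⊆ DelLocated`: a generic nonnegative column tilt has a unique optimal passenger vertex. -/
theorem delLocated_of_colSep {h K : ℕ} {q : Fam h K} (hq : ColSep h K q) : DelLocated h K q := by
  classical
  obtain ⟨x₀, hsep⟩ := hq
  obtain ⟨ω, hω0, hωsep⟩ := exists_nonneg_separating (fun (j : Fin (K + 1)) (l : Fin h) => q j (l, x₀))
  obtain ⟨j₀, -, hj₀⟩ :=
    Finset.exists_min_image Finset.univ (fun j => ω ⬝ᵥ fun l => q j (l, x₀)) Finset.univ_nonempty
  refine delLocated_of_colTilt q x₀ ω hω0 j₀ fun j => ?_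
  by_cases hj : q j = q j₀
  · exact Or.inr hj
  · left
    have hne : (fun l => q j (l, x₀)) ≠ fun l => q j₀ (l, x₀) :=
      fun hcol => hj (hsep j j₀ fun l => congrFun hcol l)
    have hlt : ω ⬝ᵥ (fun l => q j₀ (l, x₀)) < ω ⬝ᵥ fun l => q j (l, x₀) :=
      lt_of_le_of_ne (hj₀ j (Finset.mem_univ _)) (Ne.symm (hωsep j j₀ hne))
    rw [colTilt_dotProduct, colTilt_dotProduct]
    simp only [dotProduct] at hlt
    linarith

/-- ★★ `ColSep` is DECIDED (T-currency, threshold of `delLocated_decided`). -/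
theorem colSep_decided : Decided ColSep :=
  decided_anti (fun _ _ _ hq => delLocated_of_colSep hq) delLocated_decided

/-- CLASS `SwitchSep`: for some `a`, the switched-column data `(q_j(a,a), (q_j(l,l) − q_j(l,a))_{l ≠ a})` separates distinct points. -/
def SwitchSep : PClass := fun h K q => ∃ a : Fin h, ∀ j k, q j (a, a) = q k (a, a) →
  (∀ l, l ≠ a → q j (l, l) - q j (l, a) = q k (l, l) - q k (l, a)) → q j = q k

/-- ★ `SwitchSep ⊆ Sw ColSep`: column `a` of the switched points `L_a q_j` is exactly the switched-column data. -/
theorem sw_colSep_of_switchSep {h K : ℕ} {q : Fam h K} (hq : SwitchSep h K q) : Sw ColSep h K q := by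
  obtain ⟨a, hsep⟩ := hq
  refine ⟨a, a, fun j k hcol => ?_⟩
  have hjk : q j = q k := by
    refine hsep j k ?_ fun l hl => ?_
    · have := hcol a
      simp only [Function.comp_apply, swLin_apply, and_self, if_true] at this
      linarith
    · have := hcol l
      simp only [Function.comp_apply, swLin_apply, hl, false_and, if_false, if_true] at this
      exact this
  simp only [Function.comp_apply, hjk]

/-- ★★ `SwitchSep` is DECIDED (switching functor §7 ∘ `colSep_decided`; same threshold). -/
theorem switchSep_decided : Decided SwitchSep :=
  decided_anti (fun _ _ _ hq => sw_colSep_of_switchSep hq) (decided_sw colSep_decided)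

/-- … and both sieves on every `√h` principal minor and after every switching (§3/§7). -/
theorem orb_colSep_decided : Decided (Orb ColSep) := decided_orb colSep_decided

/-- ★ `Q^Π_λ ∈ SwitchSep` at EVERY `a`: its points are diagonal and pairwise distinct on the diagonal. -/
theorem qPerm_switchSep {h K : ℕ} (lam : ℝ) (hlam : 0 < lam) (a : Fin h) (e : Fin (K + 1) → Equiv.Perm (Fin h)) :
    SwitchSep h K (fun j => qPerm lam (e j)) := by
  have key : ∀ x y : ℝ, -(lam * (x + 1)) = -(lam * (y + 1)) → x = y := by
    intro x y hxy
    have h1 : lam * (x + 1) = lam * (y + 1) := by linarith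
    have h2 := mul_left_cancel₀ hlam.ne' h1
    linarith
  refine ⟨a, fun j k haa hll => ?_⟩
  have hperm : ∀ l, (((e j) l : ℕ) : ℝ) = (((e k) l : ℕ) : ℝ) := by
    intro l
    by_cases hl : l = a
    · rw [hl]
      simp only [qPerm, if_true] at haa
      exact key _ _ haa
    · have := hll l hl
      simp only [qPerm, if_true, hl, if_false, sub_zero] at this
      exact key _ _ this
  funext p
  simp only [qPerm, hperm p.1]

/-- COROLLARY: the diagonal permutahedron is decided a third time, by the sieve. -/
theorem qPerm_switchSep_decided (lam : ℝ) (hlam : 0 < lam) (c : ℕ) :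
    ∃ h₀ : ℕ, ∀ h ≥ h₀, ∀ (K : ℕ) (e : Fin (K + 1) → Equiv.Perm (Fin h)) (r : ℕ),
      HasEFOfSize (corPolytopeGraph (⊤ : SimpleGraph (Fin h)) + convexHull ℝ (Set.range fun j => qPerm lam (e j))) r →
        T c h < r := by
  obtain ⟨h₀, H⟩ := switchSep_decided c
  refine ⟨h₀ + 1, fun h hh K e r hEF => ?_⟩
  have hpos : 0 < h := by omega
  exact H h (by omega) K _ r (qPerm_switchSep lam hlam ⟨0, hpos⟩ e) hEF

/-! ## §10 (REV 6, 2026-08-28T23:45Z — pen val-idea-42 g2's rev 19/20 question (Q)) THE FULL SWITCHING CLOSURE `SwStar` / `OrbStar`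

`Orb X = Loc (X ∨ Sw X)` (§7) is ONE orbit step: on some `⌊√h⌋`-minor, as read or after ONE switching.  Here the closure under ANY finite
composite of switchings `swList L = swLin a₁ ∘ ⋯ ∘ swLin a_k` (on the minor): `SwStar X ∋ q :⟺ ∃ L, swList L ∘ q ∈ X`,
`OrbStar X := Loc (SwStar X) ⊇ Orb X ⊇ Loc X ⊇ X`.  ★★ `decided_swStar`, `decided_orbStar` (same threshold / exchange `c ↦ 2c` as `Loc`),
★★★ glue `corVirtualHard_of_residualLawOrbStar : Decided X → ResidualLaw (OrbStar X) → CorVirtualHard` — the weakest residual law of the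
three (`ResidualLaw (Loc X) → ResidualLaw (Orb X) → ResidualLaw (OrbStar X)` are NOT implications; the residual laws get WEAKER:
`residualLaw_orbStar_of_orb`, `residualLaw_orb_of_loc`).  ENEMY SPEC for `C♭_orb⋆`: outside `X` on every `⌊√h⌋` principal minor after EVERY
composite switching `x ↦ x ⊕ 𝟙_S` (`S ⊆` the minor).  The order «switch the whole family, then delete» gives the same class (a switching at
`a ∉ range ι` is invisible on the minor, at `a = ι a'` it is `swLin a'` on the minor) — not needed below, not typed. -/

/-- the composite switching along a list of vertices (`[] ↦ id`, `a :: L ↦ swLin a ∘ swList L`). -/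
def swList {h : ℕ} : List (Fin h) → ((Fin h × Fin h → ℝ) →ₗ[ℝ] (Fin h × Fin h → ℝ))
  | [] => LinearMap.id
  | a :: L => (swLin a).comp (swList L)

/-- the empty composite switching reads the family as is. -/
@[simp] theorem swList_nil_comp {h K : ℕ} (q : Fam h K) : (⇑(swList ([] : List (Fin h))) ∘ q) = q := by
  funext j; rfl

/-- a composite switching `a :: L` reads the family through `swLin a` after `swList L`. -/
@[simp] theorem swList_cons_comp {h K : ℕ} (a : Fin h) (L : List (Fin h)) (q : Fam h K) :
    (⇑(swList (a :: L)) ∘ q) = ⇑(swLin a) ∘ (⇑(swList L) ∘ q) := by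
  funext j; rfl

/-- composite switchings compose along list append. -/
theorem swList_append_comp {h K : ℕ} (L₁ L₂ : List (Fin h)) (q : Fam h K) :
    (⇑(swList (L₁ ++ L₂)) ∘ q) = ⇑(swList L₁) ∘ (⇑(swList L₂) ∘ q) := by
  induction L₁ with
  | nil => simp
  | cons a L ih => rw [List.cons_append, swList_cons_comp, swList_cons_comp, ih]

/-- ★ TRANSPORT along a composite switching: an EF of the pair is an EF of the switched pair (same size). -/
theorem hasEFOfSize_pair_swList {h K : ℕ} (L : List (Fin h)) (q : Fam h K) {r : ℕ}
    (hEF : HasEFOfSize (corPolytopeGraph (⊤ : SimpleGraph (Fin h)) + convexHull ℝ (Set.range q)) r) :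
    HasEFOfSize (corPolytopeGraph (⊤ : SimpleGraph (Fin h)) + convexHull ℝ (Set.range (⇑(swList L) ∘ q))) r := by
  induction L with
  | nil => rw [swList_nil_comp]; exact hEF
  | cons a L ih => rw [swList_cons_comp]; exact hasEFOfSize_pair_sw a _ ih

/-- transport of an EF of the passenger hull along a composite switching (same size). -/
theorem hasEFOfSize_hull_swList {h K : ℕ} (L : List (Fin h)) (q : Fam h K) {r : ℕ}
    (hEF : HasEFOfSize (convexHull ℝ (Set.range q)) r) :
    HasEFOfSize (convexHull ℝ (Set.range (⇑(swList L) ∘ q))) r := by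
  induction L with
  | nil => rw [swList_nil_comp]; exact hEF
  | cons a L ih => rw [swList_cons_comp]; exact hasEFOfSize_hull_sw a _ ih

/-- **`SwStar X`** — the SWITCHING CLOSURE of the class: `q` read through SOME composite switching lies in `X`. -/
def SwStar (X : PClass) : PClass := fun h K q => ∃ L : List (Fin h), X h K (⇑(swList L) ∘ q)

/-- `X ≤ SwStar X` (empty switching). -/
theorem le_swStar {X : PClass} {h K : ℕ} {q : Fam h K} (hq : X h K q) : SwStar X h K q :=
  ⟨[], by rw [swList_nil_comp]; exact hq⟩

/-- `Sw X ≤ SwStar X` (one switching). -/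
theorem sw_le_swStar {X : PClass} {h K : ℕ} {q : Fam h K} (hq : Sw X h K q) : SwStar X h K q := by
  obtain ⟨a, ha⟩ := hq
  exact ⟨[a], by rw [swList_cons_comp, swList_nil_comp]; exact ha⟩

/-- the closure is idempotent: `SwStar (SwStar X) ≤ SwStar X` (lists append). -/
theorem swStar_swStar_le {X : PClass} {h K : ℕ} {q : Fam h K} (hq : SwStar (SwStar X) h K q) : SwStar X h K q := by
  obtain ⟨L₁, L₂, hx⟩ := hq
  exact ⟨L₂ ++ L₁, by rw [swList_append_comp]; exact hx⟩

/-- ★★ **SWITCHING-CLOSURE THEOREM.** `Decided X → Decided (SwStar X)`, same threshold. -/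
theorem decided_swStar {X : PClass} (hX : Decided X) : Decided (SwStar X) := by
  intro c
  obtain ⟨h₀, H⟩ := hX c
  refine ⟨h₀, fun h hh K q r hq hEF => ?_⟩
  obtain ⟨L, hL⟩ := hq
  exact H h hh K _ r hL (hasEFOfSize_pair_swList L q hEF)

/-- budgeted version. -/
theorem decidedB_swStar {X : PClass} (hX : DecidedB X) : DecidedB (SwStar X) := by
  intro c
  obtain ⟨h₀, H⟩ := hX c
  refine ⟨h₀, fun h hh K q r hq hB hEF => ?_⟩
  obtain ⟨L, hL⟩ := hq
  exact H h hh K _ r hL (hasEFOfSize_hull_swList L q hB) (hasEFOfSize_pair_swList L q hEF)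

/-- **`OrbStar X := Loc (SwStar X)`** — on SOME `⌊√h⌋`-deletion minor, after SOME composite switching of the minor, `q` lies in `X`. -/
def OrbStar (X : PClass) : PClass := Loc (SwStar X)

/-- `Loc X ≤ Orb X`. -/
theorem loc_le_orb {X : PClass} {h K : ℕ} {q : Fam h K} (hq : Loc X h K q) : Orb X h K q :=
  locAt_mono Nat.sqrt (fun _ _ _ hx => Or.inl hx) hq

/-- `Orb X ≤ OrbStar X`. -/
theorem orb_le_orbStar {X : PClass} {h K : ℕ} {q : Fam h K} (hq : Orb X h K q) : OrbStar X h K q := by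
  unfold Orb at hq
  exact locAt_mono Nat.sqrt (X := fun h K q => X h K q ∨ Sw X h K q) (Y := SwStar X)
    (fun _ _ _ hx => hx.elim le_swStar sw_le_swStar) hq

/-- `X ≤ OrbStar X`. -/
theorem le_orbStar {X : PClass} {h K : ℕ} {q : Fam h K} (hq : X h K q) : OrbStar X h K q :=
  orb_le_orbStar (le_orb hq)

/-- ★★ `Decided X → Decided (OrbStar X)` (the localization exchange `c ↦ 2c` of §3, once). -/
theorem decided_orbStar {X : PClass} (hX : Decided X) : Decided (OrbStar X) :=
  decided_loc (decided_swStar hX)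

/-- the three residual laws, weakest last: `ResidualLaw (Loc X) → ResidualLaw (Orb X)` … -/
theorem residualLaw_anti {X Y : PClass} (hXY : ∀ h K (q : Fam h K), X h K q → Y h K q) (hX : ResidualLaw X) :
    ResidualLaw Y := by
  intro c
  obtain ⟨h₀, H⟩ := hX c
  exact ⟨h₀, fun h hh K q r hq hB hEF => H h hh K q r (fun hx => hq (hXY h K q hx)) hB hEF⟩

/-- `ResidualLaw (Loc X) → ResidualLaw (Orb X)`. -/
theorem residualLaw_orb_of_loc {X : PClass} (hR : ResidualLaw (Loc X)) : ResidualLaw (Orb X) :=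
  residualLaw_anti (fun _ _ _ => loc_le_orb) hR

/-- `ResidualLaw (Orb X) → ResidualLaw (OrbStar X)`. -/
theorem residualLaw_orbStar_of_orb {X : PClass} (hR : ResidualLaw (Orb X)) : ResidualLaw (OrbStar X) :=
  residualLaw_anti (fun _ _ _ => orb_le_orbStar) hR

/-- ★★★ **GLUE (switching-closure form)** — for the pen's rev 20: with `X := Cone θ τ` (the fifteen c-free decided classes) it suffices to prove
the residual law on budgeted families that are OUTSIDE `X` ON EVERY `⌊√h⌋` DELETION MINOR AFTER EVERY COMPOSITE SWITCHING. -/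
theorem corVirtualHard_of_residualLawOrbStar {X : PClass} (hX : Decided X) (hR : ResidualLaw (OrbStar X)) : CorVirtualHard :=
  corVirtualHard_of_residualLaw (decided_orbStar hX) hR

/-- the pair sieve survives the closure: `OrbStar ColSep` is decided (so a `C♭_orb⋆` enemy has, on every `√h` minor and after every composite
switching, for every column two distinct vertices agreeing on it). -/
theorem orbStar_colSep_decided : Decided (OrbStar ColSep) := decided_orbStar colSep_decided


end Summit.ValiantsHypothesis.ValiantsHypothesis.Cruxes.NNDivisionHard.Localization43
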